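/-
Copyright: harness tree, Literature layer (sorry-free). b2b-lace enum1-g51 (ENUMERATION SHARD A gen 51),
node KU-SEP-SEED-K1: soundness of the twisted SEEDCERT kernel evaluator (Part 6; complete).
-/
import Literature.Probability.FitznerVanDerHofstad2017.SrwTwistSeedCertSemantics
import Literature.Probability.FitznerVanDerHofstad2017.SrwSeedCertSoundD
import Literature.Probability.FitznerVanDerHofstad2017.SrwTwistTruncationSeeds
import HarnessLib

/-!
# Twisted SEEDCERT kernel evaluator: soundness

The main theorem `TwCert.soundT` (and its four-conjunct form `TwCert.soundT_of_parts`): if the Boolean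
certificate check `TwCert.checkT c D` holds, then for `1 ≤ n ≤ 4` the literal row object of
`SrwTwistTruncationSeeds` — `((n-1)!)⁻¹ (∫_0^∞ τ^{n-1} e^{-τ} Re (Σ_{j≤J} ε_j I_{jm}(τ/D) c_j)^D dτ)/(2π)^D`
at the weights `c_j = 2π i^j Q_j/qden` — lies in `[lo n, hi n]`.  Generic in the dimension (`D ≥ 9` is part
of the parameter check); number-free.

Ingredients: (6a) the analytic row `Ψ(u) = Σ_{j≤J} ε_j i^j (Q_j/qden) q_u(jm)` (`q_u(a) = e^{-u} I_a(u)`), its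
relation to the formal EGF power table of `SrwTwistSeedCertSemantics` (`Ψ(u)^D = e^{-Du} qden^{-D} Σ_N [s^N]G^D (u/2)^N`)
and the TWO-SIDED `[0,T]` BLOCK `|D^{n'+1}/n'! ∫_{(0,T]} u^{n'} Re Ψ(u)^D du - (P_n - e^{-λ} U_n)| ≤ R⁺_n`
(term-wise integration of the signed Poisson-tail series, dominated by the walk-count majorant `|t_N| ≤ (2D)^N`);
(6b) unpacking of the Boolean checks; (6c) the `[T,∞)` BLOCK IN BALL FORM: with `w = 1/u`,
`√(2πu) Ψ(u) = P(w) + E`, `P = Σ_j ε_j i^j (Q_j/qden) Mid_{jm}(w)` (midpoint bracket polynomials of the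
orders `jm`, `|√(2πu) q_u(a) - Mid_a(w)| ≤ eps_a w^{J_b+1}`), `‖E‖ ≤ ρ w^{J_b+1}`,
`‖P‖ ≤ α U_0(w) + ρ w^{J_b+1}`, `|Re(P+E)^D - Re P^D| ≤ G_2^D - G_1^D`, and the exact termwise tail
integrals `IM`, `IB` of the kernel's coefficient lists (`powRe`, `powN lg g_k D`); (6d)/(6e) the literal
row object equals `D^n/(n-1)! ∫_0^∞ u^{n-1} Re Ψ(u)^D du` and the final sign-aware assembly.
[cite: FitznerVanDerHofstad2016NoBLE, §5.1.1 (5.2)–(5.5) pp. 1089–1090]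
-/

set_option Elab.async false

namespace Literature.Probability.FitznerVanDerHofstad2017.SeedCert

open Real MeasureTheory Set Finset
open Literature.Probability.LatticeModels (besselI srwHeatKernel)
open scoped Nat

/-! ### Part 6a: the analytic row `Ψ`, the Poisson-block terms, the two-sided `[0,T]` block -/

section Block0

/-- **The analytic row** `Ψ(u) = Σ_{j ≤ J} ε_j i^j (Q_j/qden) q_u(jm)`, `q_u(a) = e^{-u} I_a(u)`.
[cite: FitznerVanDerHofstad2016NoBLE, §5.1.1 (5.4)–(5.5) pp. 1089–1090] -/
noncomputable def twPsi (m J : ℕ) (Q : ℕ → ℤ) (qden : ℕ) (u : ℝ) : ℂ :=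
  ∑ j ∈ range (J + 1), (epsN j : ℂ) * Complex.I ^ j * ((Q j : ℂ) / (qden : ℂ))
    * (srwHeatKernel u ((j * m : ℕ) : ℤ) : ℂ)

/-- **The Poisson-block coefficient** `t_N = N! · Re [s^N]G^D / qden^D`.
[cite: FitznerVanDerHofstad2016NoBLE, §5.1.1 (5.4)–(5.5) pp. 1089–1090] -/
noncomputable def twT (m J : ℕ) (Q : ℕ → ℤ) (qden D N : ℕ) : ℝ :=
  (N ! : ℝ) * (PowerSeries.coeff N (twG m J Q ^ D)).re / (qden : ℝ) ^ D

/-- The generic Poisson-block term `g^a_N(u) = D^{n'+1}/n'! · u^{n'} e^{-Du} · a (u/2)^N`. [cite: FitznerVanDerHofstad2016NoBLE, §5.1.1 (5.4)–(5.5) pp. 1089–1090] -/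
noncomputable def gTerm (D n' : ℕ) (a : ℝ) (N : ℕ) (u : ℝ) : ℝ :=
  (D : ℝ) ^ (n' + 1) / (n' ! : ℝ) * (u ^ n' * (Real.exp (-((D : ℝ) * u)) * (a * (u / 2) ^ N)))

/-- `Ψ(u) = e^{-u}/qden · Φ(u/2)`. [cite: FitznerVanDerHofstad2016NoBLE, §5.1.1 (5.4)–(5.5) pp. 1089–1090] -/
theorem twPsi_eq (m J : ℕ) (Q : ℕ → ℤ) (qden : ℕ) (u : ℝ) :
    twPsi m J Q qden u = ((Real.exp (-u) : ℝ) : ℂ) / (qden : ℂ) * twRowFun m J Q (u / 2) := by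
  rw [twPsi, twRowFun, Finset.mul_sum]
  refine sum_congr rfl fun j _ => ?_
  rw [srwHeatKernel_eq_exp_neg_mul_besselI, show 2 * (u / 2) = u by ring]
  push_cast
  ring

/-- `Ψ(u)^D = (e^{-Du}/qden^D) · Φ(u/2)^D`. [cite: FitznerVanDerHofstad2016NoBLE, §5.1.1 (5.4)–(5.5) pp. 1089–1090] -/
theorem twPsi_pow_eq (m J : ℕ) (Q : ℕ → ℤ) (qden : ℕ) (u : ℝ) (D : ℕ) :
    twPsi m J Q qden u ^ D
      = (((Real.exp (-((D : ℝ) * u)) / (qden : ℝ) ^ D : ℝ)) : ℂ) * twRowFun m J Q (u / 2) ^ D := by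
  have h : Real.exp (-((D : ℝ) * u)) = Real.exp (-u) ^ D := by
    rw [← Real.exp_nat_mul]; congr 1; ring
  rw [twPsi_eq, mul_pow, h]
  push_cast
  ring

/-- `Re Ψ(u)^D = (e^{-Du}/qden^D) · Re Φ(u/2)^D`. [cite: FitznerVanDerHofstad2016NoBLE, §5.1.1 (5.4)–(5.5) pp. 1089–1090] -/
theorem re_twPsi_pow (m J : ℕ) (Q : ℕ → ℤ) (qden : ℕ) (u : ℝ) (D : ℕ) :
    (twPsi m J Q qden u ^ D).re
      = Real.exp (-((D : ℝ) * u)) / (qden : ℝ) ^ D * (twRowFun m J Q (u / 2) ^ D).re := by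
  rw [twPsi_pow_eq, Complex.re_ofReal_mul]

/-- `g^a_N = a · g^1_N`. [cite: FitznerVanDerHofstad2016NoBLE, §5.1.1 (5.4)–(5.5) pp. 1089–1090] -/
theorem gTerm_eq_mul (D n' : ℕ) (a : ℝ) (N : ℕ) (u : ℝ) :
    gTerm D n' a N u = a * gTerm D n' 1 N u := by
  simp only [gTerm]; ring

/-- `0 ≤ g^1_N(u)` for `u ≥ 0`. [cite: FitznerVanDerHofstad2016NoBLE, §5.1.1 (5.4)–(5.5) pp. 1089–1090] -/
theorem gTerm_one_nonneg (D n' N : ℕ) {u : ℝ} (hu : 0 ≤ u) : 0 ≤ gTerm D n' 1 N u := by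
  unfold gTerm; positivity

/-- `g^a_N` is continuous. [cite: FitznerVanDerHofstad2016NoBLE, §5.1.1 (5.4)–(5.5) pp. 1089–1090] -/
theorem continuous_gTerm (D n' : ℕ) (a : ℝ) (N : ℕ) : Continuous (gTerm D n' a N) := by
  unfold gTerm; fun_prop

/-- **Pointwise**: `Σ_N g_N^{Re[s^N]G^D/qden^D}(u) = D^{n'+1}/n'! · u^{n'} Re Ψ(u)^D`.
[cite: FitznerVanDerHofstad2016NoBLE, §5.1.1 (5.4)–(5.5) pp. 1089–1090] -/
theorem hasSum_gTerm (m J : ℕ) (Q : ℕ → ℤ) (qden : ℕ) (hm : 0 < m)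
    (hQ : ∀ j, j ≤ J → (Q j).natAbs ≤ qden) (D : ℕ) (hD : 1 ≤ D) (n' : ℕ) (u : ℝ) :
    HasSum (fun N => gTerm D n' ((PowerSeries.coeff N (twG m J Q ^ D)).re / (qden : ℝ) ^ D) N u)
      ((D : ℝ) ^ (n' + 1) / (n' ! : ℝ) * (u ^ n' * (twPsi m J Q qden u ^ D).re)) := by
  have h := hasSum_coeff_twG_pow m J Q qden hm hQ (u / 2) D hD
  have h2 := Complex.reCLM.hasSum h
  simp only [Complex.reCLM_apply] at h2
  have h3 : HasSum (fun N => (PowerSeries.coeff N (twG m J Q ^ D)).re * (u / 2) ^ N)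
      (twRowFun m J Q (u / 2) ^ D).re := by
    refine h2.congr_fun fun N => ?_
    show _ = (PowerSeries.coeff N (twG m J Q ^ D) * ((u / 2 : ℝ) : ℂ) ^ N).re
    rw [← Complex.ofReal_pow, Complex.re_mul_ofReal]
  have h4 := h3.mul_left ((D : ℝ) ^ (n' + 1) / (n' ! : ℝ)
    * (u ^ n' * (Real.exp (-((D : ℝ) * u)) / (qden : ℝ) ^ D)))
  have h5 : HasSum (fun N => gTerm D n' ((PowerSeries.coeff N (twG m J Q ^ D)).re / (qden : ℝ) ^ D) N u)
      ((D : ℝ) ^ (n' + 1) / (n' ! : ℝ) * (u ^ n' * (Real.exp (-((D : ℝ) * u)) / (qden : ℝ) ^ D))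
        * (twRowFun m J Q (u / 2) ^ D).re) :=
    h4.congr_fun fun N => by rw [gTerm]; ring
  rw [re_twPsi_pow, show (D : ℝ) ^ (n' + 1) / (n' ! : ℝ) * (u ^ n' * (Real.exp (-((D : ℝ) * u))
      / (qden : ℝ) ^ D * (twRowFun m J Q (u / 2) ^ D).re)) = (D : ℝ) ^ (n' + 1) / (n' ! : ℝ)
      * (u ^ n' * (Real.exp (-((D : ℝ) * u)) / (qden : ℝ) ^ D)) * (twRowFun m J Q (u / 2) ^ D).re by ring]
  exact h5

/-- **Term-wise integral**: `∫_{(0,T]} g^a_N = C(N+n',n') · (a N!/(2D)^N) · Q(DT, N+n'+1)`.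
[cite: FitznerVanDerHofstad2016NoBLE, §5.1.1 (5.4)–(5.5) pp. 1089–1090] -/
theorem integral_gTerm_Ioc {D : ℕ} (hD : 1 ≤ D) (n' : ℕ) (a : ℝ) (N : ℕ) {T : ℝ} (hT : 0 ≤ T) :
    ∫ u in Ioc 0 T, gTerm D n' a N u
      = (((N + n').choose n' : ℕ) : ℝ) * (a * (N ! : ℝ) / (2 * D : ℝ) ^ N)
          * poissonTail ((D : ℝ) * T) (N + n' + 1) := by
  have hD0 : (0 : ℝ) < D := by exact_mod_cast (by omega : 0 < D)
  have hfun : (fun u => gTerm D n' a N u)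
      = fun u => ((D : ℝ) ^ (n' + 1) / (n' ! : ℝ) * (a / 2 ^ N)) * (u ^ (N + n') * Real.exp (-((D : ℝ) * u))) := by
    funext u; rw [gTerm, div_pow, pow_add]; ring
  rw [hfun, integral_const_mul, integral_pow_mul_exp_neg_mul_Ioc (N + n') hD0 hT]
  have hch : (((N + n').choose n' : ℕ) : ℝ) * ((N ! : ℝ) * (n' ! : ℝ)) = ((N + n')! : ℝ) := by
    have h := Nat.add_choose_mul_factorial_mul_factorial N n'
    exact_mod_cast (by rw [← h]; ring)
  rw [← hch]
  have hn : (n' ! : ℝ) ≠ 0 := by positivity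
  have hN : (N ! : ℝ) ≠ 0 := by positivity
  field_simp
  ring

/-- `|t_N| ≤ (2D)^N` (the walk-count majorant, `|Q_j| ≤ qden`).
[cite: FitznerVanDerHofstad2016NoBLE, §5.1.1 (5.4)–(5.5) pp. 1089–1090] -/
theorem abs_twT_le (m J : ℕ) (Q : ℕ → ℤ) (qden : ℕ) (hm : 0 < m) (hq : 0 < qden)
    (hQ : ∀ j, j ≤ J → (Q j).natAbs ≤ qden) (D : ℕ) (hD : 1 ≤ D) (N : ℕ) :
    |twT m J Q qden D N| ≤ (2 * D : ℝ) ^ N := by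
  have hb := norm_coeff_twG_pow_le m J Q qden hm hQ D hD N
  have hre := Complex.abs_re_le_norm (PowerSeries.coeff N (twG m J Q ^ D))
  have hqD : (0 : ℝ) < (qden : ℝ) ^ D := by positivity
  have hN : (0 : ℝ) ≤ (N ! : ℝ) := by positivity
  rw [twT, abs_div, abs_of_pos hqD, div_le_iff₀ hqD, abs_mul, abs_of_nonneg hN]
  calc (N ! : ℝ) * |(PowerSeries.coeff N (twG m J Q ^ D)).re|
      ≤ (N ! : ℝ) * ‖PowerSeries.coeff N (twG m J Q ^ D)‖ := mul_le_mul_of_nonneg_left hre hN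
    _ ≤ (qden : ℝ) ^ D * (2 * D : ℝ) ^ N := hb
    _ = (2 * D : ℝ) ^ N * (qden : ℝ) ^ D := mul_comm _ _

/-- The norm of the `N`-th Poisson-block term is dominated by the plain Poissonised term
`g_N^{(2D)^N/N!}(u) = D^{n'+1}/n'! u^{n'} e^{-Du} (Du)^N/N!` (`u ≥ 0`).
[cite: FitznerVanDerHofstad2016NoBLE, §5.1.1 (5.4)–(5.5) pp. 1089–1090] -/
theorem norm_gTerm_le (m J : ℕ) (Q : ℕ → ℤ) (qden : ℕ) (hm : 0 < m) (hq : 0 < qden)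
    (hQ : ∀ j, j ≤ J → (Q j).natAbs ≤ qden) (D : ℕ) (hD : 1 ≤ D) (n' N : ℕ) {u : ℝ} (hu : 0 ≤ u) :
    ‖gTerm D n' ((PowerSeries.coeff N (twG m J Q ^ D)).re / (qden : ℝ) ^ D) N u‖
      ≤ gTerm D n' ((2 * D : ℝ) ^ N / (N ! : ℝ)) N u := by
  have hb := norm_coeff_twG_pow_le m J Q qden hm hQ D hD N
  have hre := Complex.abs_re_le_norm (PowerSeries.coeff N (twG m J Q ^ D))
  have hqD : (0 : ℝ) < (qden : ℝ) ^ D := by positivity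
  have hN : (0 : ℝ) < (N ! : ℝ) := by positivity
  have key : |(PowerSeries.coeff N (twG m J Q ^ D)).re / (qden : ℝ) ^ D| ≤ (2 * D : ℝ) ^ N / (N ! : ℝ) := by
    rw [abs_div, abs_of_pos hqD, div_le_iff₀ hqD, div_mul_eq_mul_div, le_div_iff₀ hN]
    calc |(PowerSeries.coeff N (twG m J Q ^ D)).re| * (N ! : ℝ)
        ≤ ‖PowerSeries.coeff N (twG m J Q ^ D)‖ * (N ! : ℝ) := mul_le_mul_of_nonneg_right hre hN.le
      _ ≤ (2 * D : ℝ) ^ N * (qden : ℝ) ^ D := by rw [mul_comm]; linarith [hb]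
  have hW := gTerm_one_nonneg D n' N hu
  rw [gTerm_eq_mul, gTerm_eq_mul D n' ((2 * D : ℝ) ^ N / (N ! : ℝ)), norm_mul, Real.norm_of_nonneg hW,
    Real.norm_eq_abs]
  exact mul_le_mul_of_nonneg_right key hW

/-- **The `[0,T]` block is the signed Poisson-tail series**: for `T ≥ 0` and `DT < Mx + 1`,
`Σ_N C(N+n',n') (t_N/(2D)^N) Q(DT, N+n'+1) = D^{n'+1}/n'! ∫_{(0,T]} u^{n'} Re Ψ(u)^D du`
(term-wise integration, dominated by the plain Poissonised series).
[cite: FitznerVanDerHofstad2016NoBLE, §5.1.1 (5.4)–(5.5) pp. 1089–1090] -/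
theorem hasSum_block0 (m J : ℕ) (Q : ℕ → ℤ) (qden : ℕ) (hm : 0 < m) (hq : 0 < qden)
    (hQ : ∀ j, j ≤ J → (Q j).natAbs ≤ qden) (D : ℕ) (hD : 1 ≤ D) (n' : ℕ) {T : ℝ} (hT : 0 ≤ T)
    {Mx : ℕ} (hMx : (D : ℝ) * T < Mx + 1) :
    HasSum (fun N => (((N + n').choose n' : ℕ) : ℝ) * (twT m J Q qden D N / (2 * D : ℝ) ^ N)
        * poissonTail ((D : ℝ) * T) (N + n' + 1))
      ((D : ℝ) ^ (n' + 1) / (n' ! : ℝ) * ∫ u in Ioc 0 T, u ^ n' * (twPsi m J Q qden u ^ D).re) := by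
  set F : ℕ → ℝ → ℝ :=
    fun N u => gTerm D n' ((PowerSeries.coeff N (twG m J Q ^ D)).re / (qden : ℝ) ^ D) N u with hF
  have hint : ∀ N, Integrable (F N) (volume.restrict (Ioc 0 T)) :=
    fun N => (continuous_gTerm D n' _ N).integrableOn_Ioc
  have hD1 : (1 : ℝ) ≤ D := by exact_mod_cast hD
  have h2D0 : (0 : ℝ) < 2 * D := by linarith
  have hle : ∀ N, ∫ u in Ioc 0 T, ‖F N u‖
      ≤ (((N + n').choose n' : ℕ) : ℝ) * poissonTail ((D : ℝ) * T) (N + n' + 1) := by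
    intro N
    have hNf : (N ! : ℝ) ≠ 0 := by positivity
    have h2DN : (2 * D : ℝ) ^ N ≠ 0 := pow_ne_zero N h2D0.ne'
    calc ∫ u in Ioc 0 T, ‖F N u‖ ≤ ∫ u in Ioc 0 T, gTerm D n' ((2 * D : ℝ) ^ N / (N ! : ℝ)) N u := by
          refine setIntegral_mono_on (hint N).norm (continuous_gTerm D n' _ N).integrableOn_Ioc
            measurableSet_Ioc fun u hu => ?_
          exact norm_gTerm_le m J Q qden hm hq hQ D hD n' N (le_of_lt hu.1)
      _ = (((N + n').choose n' : ℕ) : ℝ) * poissonTail ((D : ℝ) * T) (N + n' + 1) := by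
          rw [integral_gTerm_Ioc hD n' _ N hT, div_mul_cancel₀ _ hNf, div_self h2DN, mul_one]
  have hnn : ∀ N, 0 ≤ ∫ u in Ioc 0 T, ‖F N u‖ := fun N => integral_nonneg fun u => norm_nonneg _
  have hlam0 : (0 : ℝ) ≤ (D : ℝ) * T := by positivity
  obtain ⟨hS, -⟩ := tsum_choose_mul_poissonTail_le hlam0 Mx n' hMx
  have hS' : Summable (fun N => (((N + n').choose n' : ℕ) : ℝ) * poissonTail ((D : ℝ) * T) (N + n' + 1)) :=
    (summable_nat_add_iff (f := fun N => (((N + n').choose n' : ℕ) : ℝ)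
      * poissonTail ((D : ℝ) * T) (N + n' + 1)) Mx).mp hS
  have hsum : Summable fun N => ∫ u in Ioc 0 T, ‖F N u‖ := Summable.of_nonneg_of_le hnn hle hS'
  have hswap := hasSum_integral_of_summable_integral_norm (μ := volume.restrict (Ioc 0 T)) hint hsum
  have hpt : (fun u => ∑' N, F N u)
      = fun u => (D : ℝ) ^ (n' + 1) / (n' ! : ℝ) * (u ^ n' * (twPsi m J Q qden u ^ D).re) :=
    funext fun u => (hasSum_gTerm m J Q qden hm hQ D hD n' u).tsum_eq
  rw [hpt, integral_const_mul] at hswap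
  refine hswap.congr_fun fun N => ?_
  simp only [hF]
  rw [integral_gTerm_Ioc hD n' _ N hT, twT]
  ring

/-- Re-indexing a sum over `range M` of a function vanishing at odd arguments by the even ones. [cite: FitznerVanDerHofstad2016NoBLE, §5.1.1 (5.4)–(5.5) pp. 1089–1090] -/
theorem sum_range_even (f : ℕ → ℝ) (hf : ∀ N, N % 2 = 1 → f N = 0) :
    ∀ M, ∑ N ∈ range M, f N = ∑ i ∈ range ((M + 1) / 2), f (2 * i)
  | 0 => by simp
  | M + 1 => by
      rw [sum_range_succ, sum_range_even f hf M]
      rcases Nat.even_or_odd M with ⟨k, hk⟩ | ⟨k, hk⟩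
      · rw [show (M + 1 + 1) / 2 = (M + 1) / 2 + 1 by omega, sum_range_succ,
          show 2 * ((M + 1) / 2) = M by omega]
      · rw [show (M + 1 + 1) / 2 = (M + 1) / 2 by omega, hf M (by omega), add_zero]

/-- `t_N = 0` for odd `N` (odd coefficients of `G^D` are purely imaginary). [cite: FitznerVanDerHofstad2016NoBLE, §5.1.1 (5.4)–(5.5) pp. 1089–1090] -/
theorem twT_odd (m J : ℕ) (Q : ℕ → ℤ) (qden D N : ℕ) (hN : N % 2 = 1) : twT m J Q qden D N = 0 := by
  have h := (parityC_pow (by omega : m % 2 < 2) (parityC_twG m J Q) D).1 N (by omega)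
  rw [twT, h, mul_zero, zero_div]

namespace TwCert

variable (c : TwCert) (D : ℕ)

/-- `λ = D t²` in `ℝ`. [cite: FitznerVanDerHofstad2016NoBLE, §5.1.1 (5.4)–(5.5) pp. 1089–1090] -/
theorem cast_lamT : (D : ℝ) * ((c.t : ℝ) ^ 2) = ((c.lamT D : ℕ) : ℝ) := by
  rw [TwCert.lamT]; push_cast; ring

/-- The real form of `R⁺_{n'+1}`. [cite: FitznerVanDerHofstad2016NoBLE, §5.1.1 (5.4)–(5.5) pp. 1089–1090] -/
theorem RplusT_real (n' : ℕ) :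
    ((c.RplusT D (n' + 1) : ℚ) : ℝ) = ((c.rHiT D : ℚ) : ℝ) *
      ((((c.M (n' + 1) : ℝ) + n' + 2) / ((c.M (n' + 1) : ℝ) + n' + 2 - (c.lamT D : ℝ)))
        * (((c.M (n' + 1) : ℝ) + 1) / ((c.M (n' + 1) : ℝ) + 1 - (c.lamT D : ℝ)))
        * (c.lamT D : ℝ) ^ (c.M (n' + 1) + n' + 1)
          / ((n' ! : ℝ) * ((c.M (n' + 1))! : ℝ) * ((c.M (n' + 1) : ℝ) + n' + 1))) := by
  simp only [RplusT, Nat.add_sub_cancel]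
  push_cast
  ring

/-- **The two-sided `[0,T]` block**: with `B₀ = D^{n'+1}/n'! ∫_{(0,T]} u^{n'} Re Ψ(u)^D du`,
`|B₀ - (P_n - e^{-λ} U_n)| ≤ R⁺_n` (`n = n'+1 ≤ 4`; `P_n`, `U_n` the exact Horner sums of the
kernel-evaluated power table, `R⁺_n` the Poisson-tail remainder majorant via `|t_N| ≤ (2D)^N`).
[cite: FitznerVanDerHofstad2016NoBLE, §5.1.1 (5.4)–(5.5) pp. 1089–1090] -/
theorem ioc_blockT (hD : 1 ≤ D) (hm : 0 < c.m) (hq : 0 < c.qden)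
    (hQ : ∀ j, j ≤ c.J → (c.Q j).natAbs ≤ c.qden) (n' : ℕ)
    (hK : c.cnt (n' + 1) ≤ c.K + 1) (hMlam : c.lamT D + 1 < c.M (n' + 1)) (helo : 0 ≤ expNegOneLo) :
    |(D : ℝ) ^ (n' + 1) / (n' ! : ℝ)
          * (∫ u in Ioc 0 ((c.t : ℝ) ^ 2), u ^ n' * (twPsi c.m c.J c.Q c.qden u ^ D).re)
        - (((c.PqT D (c.tableRe D) (n' + 1) : ℚ) : ℝ)
            - Real.exp (-(c.lamT D : ℝ)) * ((c.UqT D (c.tableRe D) (n' + 1) : ℚ) : ℝ))|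
      ≤ ((c.RplusT D (n' + 1) : ℚ) : ℝ) := by
  set M := c.M (n' + 1) with hMdef
  have hT : (0 : ℝ) ≤ (c.t : ℝ) ^ 2 := by positivity
  have hlam := c.cast_lamT D
  have hlam0 : (0 : ℝ) ≤ (c.lamT D : ℝ) := Nat.cast_nonneg _
  have hMx : (D : ℝ) * (c.t : ℝ) ^ 2 < (M : ℝ) + 1 := by
    rw [hlam]; exact_mod_cast (by omega : c.lamT D < M + 1)
  have hMlt : (c.lamT D : ℝ) < (M : ℝ) + 1 := by rw [← hlam]; exact hMx
  have hD1 : (1 : ℝ) ≤ D := by exact_mod_cast hD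
  have h2D0 : (0 : ℝ) < 2 * D := by linarith
  -- the block as the signed Poisson-tail series
  set f : ℕ → ℝ := fun N => (((N + n').choose n' : ℕ) : ℝ)
    * (twT c.m c.J c.Q c.qden D N / (2 * D : ℝ) ^ N)
    * poissonTail (c.lamT D : ℝ) (N + n' + 1) with hf
  have hHS : HasSum f ((D : ℝ) ^ (n' + 1) / (n' ! : ℝ)
      * ∫ u in Ioc 0 ((c.t : ℝ) ^ 2), u ^ n' * (twPsi c.m c.J c.Q c.qden u ^ D).re) := by
    have h := hasSum_block0 c.m c.J c.Q c.qden hm hq hQ D hD n' hT hMx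
    rw [hlam] at h
    exact h
  rw [← hHS.tsum_eq, ← hHS.summable.sum_add_tsum_nat_add M]
  -- the head `Σ_{N<M} f N = P_n - e^{-λ} U_n`
  have hodd : ∀ N, N % 2 = 1 → f N = 0 := fun N hN => by
    simp only [hf, twT_odd c.m c.J c.Q c.qden D N hN, zero_div, mul_zero, zero_mul]
  have hhead : ∑ N ∈ range M, f N = ((c.PqT D (c.tableRe D) (n' + 1) : ℚ) : ℝ)
      - Real.exp (-(c.lamT D : ℝ)) * ((c.UqT D (c.tableRe D) (n' + 1) : ℚ) : ℝ) := by
    rw [sum_range_even f hodd M, show (M + 1) / 2 = c.cnt (n' + 1) from rfl,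
      c.PqT_table_real D (n' + 1) hK hD hq, c.UqT_table_real D (n' + 1) hK hD hq,
      Finset.mul_sum, ← Finset.sum_sub_distrib]
    refine sum_congr rfl fun i _ => ?_
    simp only [hf, Nat.add_sub_cancel, twT, poissonTail, Cert.cast_EQ]
    push_cast
    ring
  rw [hhead, add_sub_cancel_left]
  -- the tail `|Σ_{N ≥ M} f N| ≤ Σ_k C(k+M+n',n') Q(λ, k+M+n'+1) ≤ R⁺`
  obtain ⟨hS, hbd⟩ := tsum_choose_mul_poissonTail_le hlam0 M n' hMlt
  have hterm : ∀ k, ‖f (k + M)‖ ≤ (((k + M + n').choose n' : ℕ) : ℝ)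
      * poissonTail (c.lamT D : ℝ) (k + M + n' + 1) := by
    intro k
    have hPT := poissonTail_nonneg hlam0 (k + M + n' + 1)
    have ht := abs_twT_le c.m c.J c.Q c.qden hm hq hQ D hD (k + M)
    have hpow : (0 : ℝ) < (2 * D : ℝ) ^ (k + M) := pow_pos h2D0 _
    have h1 : |twT c.m c.J c.Q c.qden D (k + M) / (2 * D : ℝ) ^ (k + M)| ≤ 1 := by
      rw [abs_div, abs_of_pos hpow, div_le_one hpow]; exact ht
    simp only [hf, Real.norm_eq_abs, abs_mul, Nat.abs_cast, abs_of_nonneg hPT]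
    calc (((k + M + n').choose n' : ℕ) : ℝ) * |twT c.m c.J c.Q c.qden D (k + M) / (2 * D : ℝ) ^ (k + M)|
          * poissonTail (c.lamT D : ℝ) (k + M + n' + 1)
        ≤ (((k + M + n').choose n' : ℕ) : ℝ) * 1 * poissonTail (c.lamT D : ℝ) (k + M + n' + 1) := by
          gcongr
      _ = _ := by rw [mul_one]
  have htail := tsum_of_norm_bounded hS.hasSum hterm
  rw [Real.norm_eq_abs] at htail
  refine htail.trans (hbd.trans ?_)
  rw [c.RplusT_real D n']
  obtain ⟨_, hrhi⟩ := exp_neg_nat_mem (c.lamT D) helo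
  have hrhi' : Real.exp (-(c.lamT D : ℝ)) ≤ ((c.rHiT D : ℚ) : ℝ) := by
    simpa [TwCert.rHiT] using hrhi
  apply mul_le_mul_of_nonneg_right hrhi'
  have h1 : (0 : ℝ) < (M : ℝ) + n' + 2 - (c.lamT D : ℝ) := by
    linarith [(Nat.cast_nonneg n' : (0 : ℝ) ≤ n')]
  have h2 : (0 : ℝ) < (M : ℝ) + 1 - (c.lamT D : ℝ) := by linarith
  positivity

end TwCert

end Block0


/-! ### Part 6b: unpacking of the Boolean checks -/

namespace TwCert

variable (c : TwCert) (D : ℕ)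

/-- The content of `paramsOKT` as a structure. [cite: FitznerVanDerHofstad2016NoBLE, §5.1.1 (5.4)–(5.5) pp. 1089–1090] -/
structure ParamsT : Prop where
  s0_pos : 0 < c.s0
  s0_lt : c.s0 < 1
  hT : ((c.Jb : ℚ) + 3 / 2) / (2 * c.s0 ^ 2) ≤ (c.t : ℚ) ^ 2
  t_pos : 0 < c.t
  m_pos : 0 < c.m
  hD : 9 ≤ D
  qden_pos : 0 < c.qden
  nexp_pos : 0 < c.nexp
  sLo_pos : 0 < c.sLo
  sLo_sq : c.sLo ^ 2 ≤ 2 * piLo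
  sHi_pos : 0 < c.sHi
  sHi_sq : 2 * piHi ≤ c.sHi ^ 2
  eLo_nonneg : 0 ≤ expNegOneLo
  Q_le : ∀ j, j ≤ c.J → (c.Q j).natAbs ≤ c.qden
  eps_nonneg : ∀ a ∈ c.orders, 0 ≤ c.eps a
  eps_ge : ∀ a ∈ c.orders, epsBoundQ a c.Jb c.s0 c.t c.sHi c.nexp ≤ c.eps a
  mid_dy : ∀ a ∈ c.orders, ∀ q ∈ midList a c.Jb, dyadicOK c.S q = true
  eps0_nonneg : 0 ≤ c.eps 0
  eps0_ge : epsBoundQ 0 c.Jb c.s0 c.t c.sHi c.nexp ≤ c.eps 0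
  up_dy : ∀ q ∈ upList 0 c.Jb (c.eps 0), dyadicOK c.S q = true
  up_nonneg : ∀ q ∈ upList 0 c.Jb (c.eps 0), 0 ≤ q
  alpha_dy : dyadicOK c.S c.alpha = true
  rho_dy : dyadicOK c.S c.rho = true
  rho_nonneg : 0 ≤ c.rho
  wabs_le : (c.wabsSum : ℚ) ≤ c.alpha * c.qden
  weps_le : c.wepsSum ≤ c.rho * c.qden
  M_pos : ∀ n, 1 ≤ n → n ≤ 4 → 1 ≤ c.M n
  M_le : ∀ n, 1 ≤ n → n ≤ 4 → c.M n ≤ 2 * c.K + 2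
  cnt_le : ∀ n, 1 ≤ n → n ≤ 4 → c.cnt n ≤ c.K + 1
  lam_lt : ∀ n, 1 ≤ n → n ≤ 4 → c.lamT D + 1 < c.M n

/-- Unpacking of the Boolean parameter check. [cite: FitznerVanDerHofstad2016NoBLE, §5.1.1 (5.4)–(5.5) pp. 1089–1090] -/
theorem paramsT_of_paramsOKT (h : c.paramsOKT D = true) : c.ParamsT D := by
  simp only [paramsOKT, Bool.and_eq_true, decide_eq_true_eq, List.all_eq_true, List.mem_range] at h
  obtain ⟨⟨⟨⟨⟨⟨⟨⟨⟨⟨⟨⟨⟨⟨⟨⟨⟨⟨⟨⟨⟨⟨⟨h1, h2⟩, h3⟩, h4⟩, h5⟩, h6⟩, h7⟩, h8⟩, h9⟩, h10⟩, h11⟩, h12⟩, h13⟩, h14⟩, h15⟩, h16⟩, h17⟩, h18⟩, h19⟩, h20⟩, h21⟩, h22⟩, h23⟩, h24⟩ := h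
  have hn : ∀ n, 1 ≤ n → n ≤ 4 →
      1 ≤ c.M n ∧ c.M n ≤ 2 * c.K + 2 ∧ c.cnt n ≤ c.K + 1 ∧ c.lamT D + 1 < c.M n := by
    intro n hn1 hn4
    obtain ⟨⟨⟨a1, a2⟩, a3⟩, a4⟩ := h24 (n - 1) (by omega)
    rw [show n - 1 + 1 = n by omega] at a1 a2 a3 a4
    exact ⟨a1, a2, a3, a4⟩
  exact ⟨h1, h2, h3, h4, h5, h6, h7, h8, h9, h10, h11, h12, h13,
    fun j hj => h14 j (by omega),
    fun a ha => (h15 a ha).1.1, fun a ha => (h15 a ha).1.2, fun a ha => (h15 a ha).2,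
    h16, h17, fun q hq => (h18 q hq).1, fun q hq => (h18 q hq).2, h19, h20, h21, h22, h23,
    fun n h1 h4 => (hn n h1 h4).1, fun n h1 h4 => (hn n h1 h4).2.1, fun n h1 h4 => (hn n h1 h4).2.2.1,
    fun n h1 h4 => (hn n h1 h4).2.2.2⟩

/-- Unpacking of `poissonCheckT`. [cite: FitznerVanDerHofstad2016NoBLE, §5.1.1 (5.4)–(5.5) pp. 1089–1090] -/
theorem poissonCheckT_spec (h : c.poissonCheckT D = true) (n : ℕ) (hn1 : 1 ≤ n) (hn4 : n ≤ 4) :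
    c.pLo n ≤ c.PqT D (c.tableRe D) n ∧ c.PqT D (c.tableRe D) n ≤ c.pHi n ∧
      c.uLo n ≤ c.UqT D (c.tableRe D) n ∧ c.UqT D (c.tableRe D) n ≤ c.uHi n := by
  simp only [poissonCheckT, List.all_eq_true, List.mem_range, Bool.and_eq_true,
    decide_eq_true_eq] at h
  obtain ⟨⟨⟨a1, a2⟩, a3⟩, a4⟩ := h (n - 1) (by omega)
  rw [show n - 1 + 1 = n by omega] at a1 a2 a3 a4
  exact ⟨a1, a2, a3, a4⟩

/-- Unpacking of `tailCheckT`. [cite: FitznerVanDerHofstad2016NoBLE, §5.1.1 (5.4)–(5.5) pp. 1089–1090] -/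
theorem tailCheckT_spec (h : c.tailCheckT D = true) (n : ℕ) (hn1 : 1 ≤ n) (hn4 : n ≤ 4) :
    c.imLo n ≤ c.IM D (c.powRe D) n ∧ c.IM D (c.powRe D) n ≤ c.imHi n ∧
      c.IB D (powN c.lg c.g2 D, powN c.lg c.g1 D) n ≤ c.ibHi n := by
  simp only [tailCheckT, List.all_eq_true, List.mem_range, Bool.and_eq_true,
    decide_eq_true_eq] at h
  obtain ⟨⟨a1, a2⟩, a3⟩ := h (n - 1) (by omega)
  rw [show n - 1 + 1 = n by omega] at a1 a2 a3
  exact ⟨a1, a2, a3⟩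

/-- Unpacking of `finalCheckT`. [cite: FitznerVanDerHofstad2016NoBLE, §5.1.1 (5.4)–(5.5) pp. 1089–1090] -/
theorem finalCheckT_spec (h : c.finalCheckT D = true) (n : ℕ) (hn1 : 1 ≤ n) (hn4 : n ≤ 4) :
    0 ≤ c.ibHi n ∧ c.lo n ≤ c.loFinalT D n ∧ c.hiFinalT D n ≤ c.hi n := by
  simp only [finalCheckT, List.all_eq_true, List.mem_range, Bool.and_eq_true,
    decide_eq_true_eq] at h
  obtain ⟨⟨a1, a2⟩, a3⟩ := h (n - 1) (by omega)
  rw [show n - 1 + 1 = n by omega] at a1 a2 a3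
  exact ⟨a1, a2, a3⟩

/-- Unpacking of `checkT`. [cite: FitznerVanDerHofstad2016NoBLE, §5.1.1 (5.4)–(5.5) pp. 1089–1090] -/
theorem checkT_spec (h : c.checkT D = true) :
    c.paramsOKT D = true ∧ c.finalCheckT D = true ∧ c.poissonCheckT D = true ∧ c.tailCheckT D = true := by
  simp only [checkT, Bool.and_eq_true] at h
  obtain ⟨⟨⟨a1, a2⟩, a3⟩, a4⟩ := h
  exact ⟨a1, a2, a3, a4⟩

/-- **The `[0,T]` block from the checks**: `pLo n - eUB n - R⁺_n ≤ B₀ ≤ pHi n - eLB n + R⁺_n` (`n = n'+1 ≤ 4`).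
[cite: FitznerVanDerHofstad2016NoBLE, §5.1.1 (5.4)–(5.5) pp. 1089–1090] -/
theorem ioc_blockT_bracket (hp : c.ParamsT D) (hpc : c.poissonCheckT D = true) (n' : ℕ) (hn : n' ≤ 3) :
    ((c.pLo (n' + 1) : ℚ) : ℝ) - ((c.eUB D (n' + 1) : ℚ) : ℝ) - ((c.RplusT D (n' + 1) : ℚ) : ℝ)
      ≤ (D : ℝ) ^ (n' + 1) / (n' ! : ℝ)
          * (∫ u in Ioc 0 ((c.t : ℝ) ^ 2), u ^ n' * (twPsi c.m c.J c.Q c.qden u ^ D).re) ∧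
    (D : ℝ) ^ (n' + 1) / (n' ! : ℝ)
          * (∫ u in Ioc 0 ((c.t : ℝ) ^ 2), u ^ n' * (twPsi c.m c.J c.Q c.qden u ^ D).re)
      ≤ ((c.pHi (n' + 1) : ℚ) : ℝ) - ((c.eLB D (n' + 1) : ℚ) : ℝ) + ((c.RplusT D (n' + 1) : ℚ) : ℝ) := by
  have hn1 : 1 ≤ n' + 1 := by omega
  have hn4 : n' + 1 ≤ 4 := by omega
  have hD : 1 ≤ D := le_trans (by norm_num) hp.hD
  have hblk := c.ioc_blockT D hD hp.m_pos hp.qden_pos hp.Q_le n' (hp.cnt_le _ hn1 hn4)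
    (hp.lam_lt _ hn1 hn4) hp.eLo_nonneg
  obtain ⟨hpl, hph, hul, huh⟩ := c.poissonCheckT_spec D hpc (n' + 1) hn1 hn4
  obtain ⟨hrlo, hrhi⟩ := exp_neg_nat_mem (c.lamT D) hp.eLo_nonneg
  have hrlo' : ((c.rLoT D : ℚ) : ℝ) ≤ Real.exp (-(c.lamT D : ℝ)) := by simpa [TwCert.rLoT] using hrlo
  have hrhi' : Real.exp (-(c.lamT D : ℝ)) ≤ ((c.rHiT D : ℚ) : ℝ) := by simpa [TwCert.rHiT] using hrhi
  have he0 : 0 ≤ Real.exp (-(c.lamT D : ℝ)) := (Real.exp_pos _).le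
  set E := Real.exp (-(c.lamT D : ℝ)) * ((c.UqT D (c.tableRe D) (n' + 1) : ℚ) : ℝ) with hE
  -- `eLB ≤ e^{-λ} U ≤ eUB` (sign-aware)
  have hUB : E ≤ ((c.eUB D (n' + 1) : ℚ) : ℝ) := by
    rw [TwCert.eUB]
    split_ifs with hs
    · push_cast
      have hu : ((c.UqT D (c.tableRe D) (n' + 1) : ℚ) : ℝ) ≤ ((c.uHi (n' + 1) : ℚ) : ℝ) := by exact_mod_cast huh
      have hs' : (0 : ℝ) ≤ ((c.uHi (n' + 1) : ℚ) : ℝ) := by exact_mod_cast hs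
      calc E ≤ Real.exp (-(c.lamT D : ℝ)) * ((c.uHi (n' + 1) : ℚ) : ℝ) := mul_le_mul_of_nonneg_left hu he0
        _ ≤ _ := mul_le_mul_of_nonneg_right hrhi' hs'
    · push_cast
      rw [not_le] at hs
      have hu : ((c.UqT D (c.tableRe D) (n' + 1) : ℚ) : ℝ) ≤ ((c.uHi (n' + 1) : ℚ) : ℝ) := by exact_mod_cast huh
      have hs' : ((c.uHi (n' + 1) : ℚ) : ℝ) ≤ 0 := by exact_mod_cast hs.le
      calc E ≤ Real.exp (-(c.lamT D : ℝ)) * ((c.uHi (n' + 1) : ℚ) : ℝ) := mul_le_mul_of_nonneg_left hu he0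
        _ ≤ _ := by
          rw [mul_comm, mul_comm (((c.rLoT D : ℚ) : ℝ))]
          exact mul_le_mul_of_nonpos_left hrlo' hs'
  have hLB : ((c.eLB D (n' + 1) : ℚ) : ℝ) ≤ E := by
    rw [TwCert.eLB]
    split_ifs with hs
    · push_cast
      have hu : ((c.uLo (n' + 1) : ℚ) : ℝ) ≤ ((c.UqT D (c.tableRe D) (n' + 1) : ℚ) : ℝ) := by exact_mod_cast hul
      have hs' : (0 : ℝ) ≤ ((c.uLo (n' + 1) : ℚ) : ℝ) := by exact_mod_cast hs
      calc ((c.rLoT D : ℚ) : ℝ) * ((c.uLo (n' + 1) : ℚ) : ℝ)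
          ≤ Real.exp (-(c.lamT D : ℝ)) * ((c.uLo (n' + 1) : ℚ) : ℝ) := mul_le_mul_of_nonneg_right hrlo' hs'
        _ ≤ E := mul_le_mul_of_nonneg_left hu he0
    · push_cast
      rw [not_le] at hs
      have hu : ((c.uLo (n' + 1) : ℚ) : ℝ) ≤ ((c.UqT D (c.tableRe D) (n' + 1) : ℚ) : ℝ) := by exact_mod_cast hul
      have hs' : ((c.uLo (n' + 1) : ℚ) : ℝ) ≤ 0 := by exact_mod_cast hs.le
      calc ((c.rHiT D : ℚ) : ℝ) * ((c.uLo (n' + 1) : ℚ) : ℝ)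
          ≤ Real.exp (-(c.lamT D : ℝ)) * ((c.uLo (n' + 1) : ℚ) : ℝ) := by
            rw [mul_comm, mul_comm (Real.exp _)]
            exact mul_le_mul_of_nonpos_left hrhi' hs'
        _ ≤ E := mul_le_mul_of_nonneg_left hu he0
  have hP1 : ((c.pLo (n' + 1) : ℚ) : ℝ) ≤ ((c.PqT D (c.tableRe D) (n' + 1) : ℚ) : ℝ) := by exact_mod_cast hpl
  have hP2 : ((c.PqT D (c.tableRe D) (n' + 1) : ℚ) : ℝ) ≤ ((c.pHi (n' + 1) : ℚ) : ℝ) := by exact_mod_cast hph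
  rw [abs_le] at hblk
  obtain ⟨hb1, hb2⟩ := hblk
  constructor <;> linarith

end TwCert


/-! ### Part 6d: the literal row object (`τ`-form of `SrwTwistTruncationSeeds`) in the `u`-form -/

section Literal

/-- `ε_j` as a complex literal. [cite: FitznerVanDerHofstad2016NoBLE, §5.1.1 (5.4)–(5.5) pp. 1089–1090] -/
theorem epsN_cast (j : ℕ) : ((epsN j : ℕ) : ℂ) = if j = 0 then (1 : ℂ) else 2 := by
  unfold epsN; split_ifs <;> simp

/-- The twisted row at `c_j = 2π i^j Q_j/qden` is `(2π/qden) Φ(u/2)`.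
[cite: FitznerVanDerHofstad2016NoBLE, §5.1.1 (5.4)–(5.5) pp. 1089–1090] -/
theorem rowLit_sum_eq (m J : ℕ) (Q : ℕ → ℤ) (qden : ℕ) (hq : 0 < qden) (u : ℝ) :
    ∑ j ∈ Finset.range (J + 1), (if j = 0 then (1 : ℂ) else 2)
        * ((besselI ((j : ℤ) * (m : ℤ)) u : ℂ)
            * (2 * π * Complex.I ^ j * (((Q j : ℝ) / (qden : ℝ) : ℝ) : ℂ)))
      = ((2 * π / (qden : ℝ) : ℝ) : ℂ) * twRowFun m J Q (u / 2) := by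
  have hq0 : (qden : ℂ) ≠ 0 := by exact_mod_cast hq.ne'
  rw [twRowFun, Finset.mul_sum]
  refine sum_congr rfl fun j _ => ?_
  rw [← epsN_cast, show 2 * (u / 2) = u by ring]
  push_cast
  field_simp

/-- Pointwise: `e^{-Du} Re(Σ_j ε_j I_{jm}(u) c_j)^D = (2π)^D Re Ψ(u)^D` at `c_j = 2π i^j Q_j/qden`.
[cite: FitznerVanDerHofstad2016NoBLE, §5.1.1 (5.4)–(5.5) pp. 1089–1090] -/
theorem rowLit_integrand (m J : ℕ) (Q : ℕ → ℤ) (qden : ℕ) (hq : 0 < qden) (D : ℕ) (u : ℝ) :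
    Real.exp (-((D : ℝ) * u)) *
        ((∑ j ∈ Finset.range (J + 1), (if j = 0 then (1 : ℂ) else 2)
          * ((besselI ((j : ℤ) * (m : ℤ)) u : ℂ)
              * (2 * π * Complex.I ^ j * (((Q j : ℝ) / (qden : ℝ) : ℝ) : ℂ)))) ^ D).re
      = (2 * π) ^ D * (twPsi m J Q qden u ^ D).re := by
  have hq0 : (qden : ℝ) ≠ 0 := by exact_mod_cast hq.ne'
  rw [rowLit_sum_eq m J Q qden hq u, mul_pow, twPsi_pow_eq, ← Complex.ofReal_pow, Complex.re_ofReal_mul,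
    Complex.re_ofReal_mul, div_pow]
  field_simp

/-- **The literal row object in the `u`-form** (`τ = D u`):
`(1/n'!) ∫₀^∞ τ^{n'} e^{-τ} Re(Σ_j ε_j I_{jm}(τ/D) c_j)^D dτ / (2π)^D = D^{n'+1}/n'! ∫₀^∞ u^{n'} Re Ψ(u)^D du`
at `c_j = 2π i^j Q_j/qden`. [cite: FitznerVanDerHofstad2016NoBLE, §5.1.1 (5.2)–(5.5) pp. 1089–1090] -/
theorem rowLit_eq_ublock (m J : ℕ) (Q : ℕ → ℤ) (qden : ℕ) (hq : 0 < qden) {D : ℕ} (hD : 1 ≤ D) (n' : ℕ) :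
    (n' ! : ℝ)⁻¹ * (∫ τ in Ioi (0:ℝ), τ ^ n' * (Real.exp (-τ) *
        ((∑ j ∈ Finset.range (J + 1), (if j = 0 then (1 : ℂ) else 2)
          * ((besselI ((j : ℤ) * (m : ℤ)) (τ / D) : ℂ)
              * (2 * π * Complex.I ^ j * (((Q j : ℝ) / (qden : ℝ) : ℝ) : ℂ)))) ^ D).re)) / (2 * π) ^ D
      = (D : ℝ) ^ (n' + 1) / (n' ! : ℝ) * ∫ u in Ioi (0:ℝ), u ^ n' * (twPsi m J Q qden u ^ D).re := by
  have hD0 : (0 : ℝ) < D := by exact_mod_cast (by omega : 0 < D)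
  have hπ : (0 : ℝ) < 2 * π := by positivity
  set g : ℝ → ℝ := fun u => ((D : ℝ) * u) ^ n' * ((2 * π) ^ D * (twPsi m J Q qden u ^ D).re) with hg
  have hint : (fun τ : ℝ => τ ^ n' * (Real.exp (-τ) *
        ((∑ j ∈ Finset.range (J + 1), (if j = 0 then (1 : ℂ) else 2)
          * ((besselI ((j : ℤ) * (m : ℤ)) (τ / D) : ℂ)
              * (2 * π * Complex.I ^ j * (((Q j : ℝ) / (qden : ℝ) : ℝ) : ℂ)))) ^ D).re))
      = fun τ => g ((D : ℝ)⁻¹ * τ) := by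
    funext τ
    have hu : (D : ℝ) * ((D : ℝ)⁻¹ * τ) = τ := by field_simp
    rw [hg]
    beta_reduce
    rw [← rowLit_integrand m J Q qden hq D ((D : ℝ)⁻¹ * τ), hu,
      show τ / (D : ℝ) = (D : ℝ)⁻¹ * τ by rw [div_eq_inv_mul]]
  rw [hint, integral_comp_mul_left_Ioi g 0 (inv_pos.mpr hD0)]
  simp only [mul_zero, inv_inv, smul_eq_mul]
  have hg' : g = fun u => ((D : ℝ) ^ n' * (2 * π) ^ D) * (u ^ n' * (twPsi m J Q qden u ^ D).re) := by
    funext u; rw [hg, mul_pow]; ring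
  rw [hg', integral_const_mul]
  have hπD : ((2 : ℝ) * π) ^ D ≠ 0 := pow_ne_zero _ hπ.ne'
  have hn : (n' ! : ℝ) ≠ 0 := by positivity
  field_simp
  ring

end Literal


/-! ### Part 6e: integrability on `(0,∞)`, the split at `T`, and the assembly modulo the `[T,∞)` block -/

section Assembly

/-- `Σ_{j ≤ J} ε_j = 2J+1`. [cite: FitznerVanDerHofstad2016NoBLE, §5.1.1 (5.4)–(5.5) pp. 1089–1090] -/
theorem sum_epsN (J : ℕ) : ∑ j ∈ Finset.range (J + 1), (epsN j : ℝ) = 2 * J + 1 := by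
  induction J with
  | zero => simp [epsN]
  | succ J ih =>
    rw [Finset.sum_range_succ, ih]
    simp [epsN]
    ring

/-- `Ψ` is continuous. [cite: FitznerVanDerHofstad2016NoBLE, §5.1.1 (5.4)–(5.5) pp. 1089–1090] -/
theorem continuous_twPsi (m J : ℕ) (Q : ℕ → ℤ) (qden : ℕ) : Continuous (twPsi m J Q qden) := by
  unfold twPsi
  refine continuous_finsetSum _ fun j _ => ?_
  exact continuous_const.mul (Complex.continuous_ofReal.comp
    (Literature.Probability.LatticeModels.continuous_srwHeatKernel_left _))

/-- `‖Ψ(u)‖ ≤ (2J+1) q_u(0)` for `u ≥ 0` when `|Q_j| ≤ qden`. [cite: DLMF, 10.37] -/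
theorem norm_twPsi_le (m J : ℕ) (Q : ℕ → ℤ) (qden : ℕ) (hq : 0 < qden)
    (hQ : ∀ j, j ≤ J → (Q j).natAbs ≤ qden) {u : ℝ} (hu : 0 ≤ u) :
    ‖twPsi m J Q qden u‖ ≤ (2 * J + 1) * srwHeatKernel u 0 := by
  unfold twPsi
  refine (norm_sum_le _ _).trans ?_
  rw [← sum_epsN, Finset.sum_mul]
  refine Finset.sum_le_sum fun j hj => ?_
  rw [Finset.mem_range] at hj
  have hq0 : (0 : ℝ) < qden := by exact_mod_cast hq
  have hQj : ‖((Q j : ℂ) / (qden : ℂ))‖ ≤ 1 := by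
    rw [norm_div, Complex.norm_intCast, Complex.norm_natCast, div_le_one hq0]
    have := hQ j (by omega)
    have h' : ((Q j).natAbs : ℝ) ≤ qden := by exact_mod_cast this
    rwa [Nat.cast_natAbs, Int.cast_abs] at h'
  have hk0 : 0 ≤ srwHeatKernel u ((j * m : ℕ) : ℤ) := srwHeatKernel_nonneg hu _
  have hk : srwHeatKernel u ((j * m : ℕ) : ℤ) ≤ srwHeatKernel u 0 := srwHeatKernel_le_zero_index hu _
  rw [norm_mul, norm_mul, norm_mul, Complex.norm_natCast, norm_pow, Complex.norm_I, one_pow, mul_one,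
    Complex.norm_real, Real.norm_eq_abs, abs_of_nonneg hk0]
  calc (epsN j : ℝ) * ‖((Q j : ℂ) / (qden : ℂ))‖ * srwHeatKernel u ((j * m : ℕ) : ℤ)
      ≤ (epsN j : ℝ) * 1 * srwHeatKernel u 0 := by gcongr
    _ = (epsN j : ℝ) * srwHeatKernel u 0 := by ring

/-- `u ↦ uⁿ' q_u(0)^D` is integrable on `(0,∞)` for `D ≥ 2n'+3` (`u`-form of
`integrableOn_pow_mul_srwHeatKernel_zero_pow`). [cite: FitznerVanDerHofstad2016NoBLE, §5.1.1 (5.2)–(5.4)] -/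
theorem integrableOn_pow_mul_srwHeatKernel_zero_pow_u (n' : ℕ) {D : ℕ} (hD : 2 * n' + 3 ≤ D) :
    IntegrableOn (fun u : ℝ => u ^ n' * srwHeatKernel u 0 ^ D) (Ioi 0) := by
  have hD0 : (0 : ℝ) < D := by exact_mod_cast (by omega : 0 < D)
  have h := (integrableOn_Ioi_comp_mul_left_iff
    (fun τ : ℝ => τ ^ n' * srwHeatKernel (τ / D) 0 ^ D) 0 hD0).mpr
    (by rw [mul_zero]; exact integrableOn_pow_mul_srwHeatKernel_zero_pow n' hD)
  refine IntegrableOn.congr_fun (h.const_mul (((D : ℝ) ^ n')⁻¹)) (fun u _ => ?_) measurableSet_Ioi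
  simp only [mul_div_cancel_left₀ u hD0.ne', mul_pow]
  field_simp

/-- **Integrability of `uⁿ' Re Ψ(u)^D` on `(0,∞)`** for `D ≥ 2n'+3`.
[cite: FitznerVanDerHofstad2016NoBLE, §5.1.1 (5.2)–(5.4)] -/
theorem integrableOn_ublock (m J : ℕ) (Q : ℕ → ℤ) (qden : ℕ) (hq : 0 < qden)
    (hQ : ∀ j, j ≤ J → (Q j).natAbs ≤ qden) (n' : ℕ) {D : ℕ} (hD : 2 * n' + 3 ≤ D) :
    IntegrableOn (fun u : ℝ => u ^ n' * (twPsi m J Q qden u ^ D).re) (Ioi 0) := by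
  have hcont : Continuous (fun u : ℝ => u ^ n' * (twPsi m J Q qden u ^ D).re) :=
    (continuous_pow n').mul (Complex.continuous_re.comp ((continuous_twPsi m J Q qden).pow D))
  have hdom := (integrableOn_pow_mul_srwHeatKernel_zero_pow_u n' hD).const_mul ((2 * J + 1 : ℝ) ^ D)
  refine Integrable.mono' hdom hcont.aestronglyMeasurable ?_
  rw [ae_restrict_iff' measurableSet_Ioi]
  refine Filter.Eventually.of_forall fun u (hu : 0 < u) => ?_
  have hk0 : 0 ≤ srwHeatKernel u 0 := srwHeatKernel_nonneg hu.le _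
  rw [norm_mul, norm_pow, Real.norm_eq_abs, abs_of_pos hu, Real.norm_eq_abs]
  calc u ^ n' * |(twPsi m J Q qden u ^ D).re| ≤ u ^ n' * ‖twPsi m J Q qden u‖ ^ D := by
        gcongr
        exact (Complex.abs_re_le_norm _).trans (norm_pow _ _).le
    _ ≤ u ^ n' * ((2 * J + 1) * srwHeatKernel u 0) ^ D := by
        gcongr
        exact norm_twPsi_le m J Q qden hq hQ hu.le
    _ = (2 * J + 1 : ℝ) ^ D * (u ^ n' * srwHeatKernel u 0 ^ D) := by rw [mul_pow]; ring

/-- The split `∫₀^∞ = ∫_{(0,T]} + ∫_{(T,∞)}` of the `u`-form. [cite: FitznerVanDerHofstad2016NoBLE, §5.1.1 (5.4)–(5.5) pp. 1089–1090] -/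
theorem integral_ublock_split (m J : ℕ) (Q : ℕ → ℤ) (qden : ℕ) (hq : 0 < qden)
    (hQ : ∀ j, j ≤ J → (Q j).natAbs ≤ qden) (n' : ℕ) {D : ℕ} (hD : 2 * n' + 3 ≤ D) {T : ℝ} (hT : 0 ≤ T) :
    ∫ u in Ioi 0, u ^ n' * (twPsi m J Q qden u ^ D).re
      = (∫ u in Ioc 0 T, u ^ n' * (twPsi m J Q qden u ^ D).re)
        + ∫ u in Ioi T, u ^ n' * (twPsi m J Q qden u ^ D).re := by
  have hint := integrableOn_ublock m J Q qden hq hQ n' hD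
  rw [← Ioc_union_Ioi_eq_Ioi hT, setIntegral_union Ioc_disjoint_Ioi_same measurableSet_Ioi
    (hint.mono_set Ioc_subset_Ioi_self) (hint.mono_set (Ioi_subset_Ioi hT))]

namespace TwCert

variable (c : TwCert) (D : ℕ)

/-- The certificate's complex coefficients `c_j = 2π i^j Q_j/qden`. [cite: FitznerVanDerHofstad2016NoBLE, §5.1.1 (5.4)–(5.5) pp. 1089–1090] -/
noncomputable def cT (j : ℕ) : ℂ := 2 * π * Complex.I ^ j * (((c.Q j : ℝ) / (c.qden : ℝ) : ℝ) : ℂ)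

/-- The `[T,∞)` block statement (divided by the prefactor): `tailLo_n ≤ ∫_T^∞ u^{n'} Re Ψ^D ≤ tailHi_n`, `n = n'+1`.
[cite: FitznerVanDerHofstad2016NoBLE, §5.1.1 (5.4)–(5.5) pp. 1089–1090] -/
def IoiBlockT (n' : ℕ) : Prop :=
  ((c.tailLo D (n' + 1) : ℚ) : ℝ) ≤ ∫ u in Ioi ((c.t : ℝ) ^ 2), u ^ n' * (twPsi c.m c.J c.Q c.qden u ^ D).re ∧
  ∫ u in Ioi ((c.t : ℝ) ^ 2), u ^ n' * (twPsi c.m c.J c.Q c.qden u ^ D).re ≤ ((c.tailHi D (n' + 1) : ℚ) : ℝ)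

/-- The prefactor cast: `prefD D (n'+1) = D^{n'+1}/n'!`. [cite: FitznerVanDerHofstad2016NoBLE, §5.1.1 (5.4)–(5.5) pp. 1089–1090] -/
theorem cast_prefD (n' : ℕ) : ((Cert.prefD D (n' + 1) : ℚ) : ℝ) = (D : ℝ) ^ (n' + 1) / (n' ! : ℝ) := by
  rw [Cert.prefD, Nat.add_sub_cancel]
  push_cast
  rfl

/-- **Soundness of the twisted SEEDCERT modulo the `[T,∞)` block**: if `checkT` holds and the tail block
brackets `IoiBlockT` hold for `n' ≤ 3`, then for `1 ≤ n ≤ 4` the literal row object of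
`SrwTwistTruncationSeeds` at `c_j = 2π i^j Q_j/qden` lies in `[lo n, hi n]`.
[cite: FitznerVanDerHofstad2016NoBLE, §5.1.1 (5.2)–(5.5) pp. 1089–1090] -/
theorem soundT_of_ioiBlockT (h : c.checkT D = true) (htail : ∀ n', n' ≤ 3 → c.IoiBlockT D n')
    (n : ℕ) (hn1 : 1 ≤ n) (hn4 : n ≤ 4) :
    ((c.lo n : ℚ) : ℝ)
        ≤ ((n - 1) ! : ℝ)⁻¹ * (∫ τ in Ioi (0:ℝ), τ ^ (n - 1) * (Real.exp (-τ) *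
            ((∑ j ∈ Finset.range (c.J + 1), (if j = 0 then (1 : ℂ) else 2)
              * ((besselI (j * (c.m : ℤ)) (τ / D) : ℂ) * c.cT j)) ^ D).re)) / (2 * π) ^ D ∧
    ((n - 1) ! : ℝ)⁻¹ * (∫ τ in Ioi (0:ℝ), τ ^ (n - 1) * (Real.exp (-τ) *
            ((∑ j ∈ Finset.range (c.J + 1), (if j = 0 then (1 : ℂ) else 2)
              * ((besselI (j * (c.m : ℤ)) (τ / D) : ℂ) * c.cT j)) ^ D).re)) / (2 * π) ^ D
        ≤ ((c.hi n : ℚ) : ℝ) := by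
  obtain ⟨h1, h4, h2, _h3⟩ := c.checkT_spec D h
  have hp := c.paramsT_of_paramsOKT D h1
  obtain ⟨n', rfl⟩ : ∃ n', n = n' + 1 := ⟨n - 1, by omega⟩
  have hn : n' ≤ 3 := by omega
  have hD1 : 1 ≤ D := le_trans (by norm_num) hp.hD
  have hD3 : 2 * n' + 3 ≤ D := by have := hp.hD; omega
  have hT : (0 : ℝ) ≤ (c.t : ℝ) ^ 2 := by positivity
  simp only [Nat.add_sub_cancel, TwCert.cT]
  rw [rowLit_eq_ublock c.m c.J c.Q c.qden hp.qden_pos hD1 n',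
    integral_ublock_split c.m c.J c.Q c.qden hp.qden_pos hp.Q_le n' hD3 hT, mul_add]
  obtain ⟨hB0lo, hB0hi⟩ := c.ioc_blockT_bracket D hp h2 n' hn
  obtain ⟨hB1lo, hB1hi⟩ := htail n' hn
  obtain ⟨_, hlo, hhi⟩ := c.finalCheckT_spec D h4 (n' + 1) (by omega) (by omega)
  have qlo : ((c.lo (n' + 1) : ℚ) : ℝ) ≤ ((c.loFinalT D (n' + 1) : ℚ) : ℝ) := by exact_mod_cast hlo
  have qhi : ((c.hiFinalT D (n' + 1) : ℚ) : ℝ) ≤ ((c.hi (n' + 1) : ℚ) : ℝ) := by exact_mod_cast hhi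
  rw [TwCert.loFinalT] at qlo
  rw [TwCert.hiFinalT] at qhi
  push_cast at qlo qhi
  rw [cast_prefD] at qlo qhi
  have hpref0 : (0 : ℝ) ≤ (D : ℝ) ^ (n' + 1) / (n' ! : ℝ) := by positivity
  have hC := mul_le_mul_of_nonneg_left hB1lo hpref0
  have hD' := mul_le_mul_of_nonneg_left hB1hi hpref0
  constructor <;> linarith

end TwCert

end Assembly


/-! ### Part 6c-i: semantics of the `[T,∞)` lists — coefficient lists as polynomials in `w` -/

section TailSem

open Polynomial

/-- Coefficients of `toPolyN`. [cite: FitznerVanDerHofstad2016NoBLE, §5.1.1 (5.4)–(5.5) pp. 1089–1090] -/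
theorem coeff_toPolyN : ∀ (l : List ℕ) (k : ℕ), (toPolyN l).coeff k = ((l.getD k 0 : ℕ) : ℝ)
  | [], k => by simp
  | a :: as, 0 => by simp
  | a :: as, k + 1 => by
      rw [toPolyN_cons, coeff_add, coeff_X_mul, coeff_toPolyN as k, coeff_C]
      simp

/-- Coefficients of `toPolyQ`. [cite: FitznerVanDerHofstad2016NoBLE, §5.1.1 (5.4)–(5.5) pp. 1089–1090] -/
theorem coeff_toPolyQ : ∀ (l : List ℚ) (k : ℕ), (toPolyQ l).coeff k = ((l.getD k 0 : ℚ) : ℝ)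
  | [], k => by simp
  | a :: as, 0 => by simp
  | a :: as, k + 1 => by
      rw [toPolyQ_cons, coeff_add, coeff_X_mul, coeff_toPolyQ as k, coeff_C]
      simp

/-- Coefficients of `toPolyZ`. [cite: FitznerVanDerHofstad2016NoBLE, §5.1.1 (5.4)–(5.5) pp. 1089–1090] -/
theorem coeff_toPolyZ : ∀ (l : List ℤ) (k : ℕ), (toPolyZ l).coeff k = ((l.getD k 0 : ℤ) : ℝ)
  | [], k => by simp
  | a :: as, 0 => by simp
  | a :: as, k + 1 => by
      rw [toPolyZ_cons, coeff_add, coeff_X_mul, coeff_toPolyZ as k, coeff_C]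
      simp

/-- The signed polynomial `pos(w) - neg(w)` of a `(pos, neg)` pair. [cite: FitznerVanDerHofstad2016NoBLE, §5.1.1 (5.4)–(5.5) pp. 1089–1090] -/
noncomputable def pnPoly (P : List ℕ × List ℕ) : ℝ[X] := toPolyN P.1 - toPolyN P.2

/-- Coefficients of `pnPoly` are the `zval`s. [cite: FitznerVanDerHofstad2016NoBLE, §5.1.1 (5.4)–(5.5) pp. 1089–1090] -/
theorem coeff_pnPoly (P : List ℕ × List ℕ) (k : ℕ) : (pnPoly P).coeff k = ((zval P k : ℤ) : ℝ) := by
  simp [pnPoly, coeff_toPolyN, zval]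

/-- `zval` vanishes beyond both lengths. [cite: FitznerVanDerHofstad2016NoBLE, §5.1.1 (5.4)–(5.5) pp. 1089–1090] -/
theorem zval_eq_zero_of_le {P : List ℕ × List ℕ} {k : ℕ} (h1 : P.1.length ≤ k) (h2 : P.2.length ≤ k) :
    zval P k = 0 := by
  simp [zval, List.getD_eq_getElem?_getD, List.getElem?_eq_none_iff.mpr h1,
    List.getElem?_eq_none_iff.mpr h2]

/-- All four lists of `X` have length `≤ A`. [cite: FitznerVanDerHofstad2016NoBLE, §5.1.1 (5.4)–(5.5) pp. 1089–1090] -/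
def GZle (X : GZ) (A : ℕ) : Prop :=
  X.1.1.length ≤ A ∧ X.1.2.length ≤ A ∧ X.2.1.length ≤ A ∧ X.2.2.length ≤ A

/-- `GZlen` gives `GZle`. [cite: FitznerVanDerHofstad2016NoBLE, §5.1.1 (5.4)–(5.5) pp. 1089–1090] -/
theorem GZle.of_len {X : GZ} {L : ℕ} (h : GZlen X L) : GZle X L :=
  ⟨h.1.le, h.2.1.le, h.2.2.1.le, h.2.2.2.le⟩

/-- Monotonicity of `GZle`. [cite: FitznerVanDerHofstad2016NoBLE, §5.1.1 (5.4)–(5.5) pp. 1089–1090] -/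
theorem GZle.mono {X : GZ} {A B : ℕ} (h : GZle X A) (hAB : A ≤ B) : GZle X B :=
  ⟨h.1.trans hAB, h.2.1.trans hAB, h.2.2.1.trans hAB, h.2.2.2.trans hAB⟩

/-- The complex polynomial `Re(w) + i Im(w)` of a `GZ`. [cite: FitznerVanDerHofstad2016NoBLE, §5.1.1 (5.4)–(5.5) pp. 1089–1090] -/
noncomputable def cPoly (X : GZ) : ℂ[X] :=
  (pnPoly X.1).map Complex.ofRealHom + C Complex.I * (pnPoly X.2).map Complex.ofRealHom

/-- Coefficients of `cPoly`. [cite: FitznerVanDerHofstad2016NoBLE, §5.1.1 (5.4)–(5.5) pp. 1089–1090] -/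
theorem coeff_cPoly (X : GZ) (k : ℕ) :
    (cPoly X).coeff k = ((zval X.1 k : ℤ) : ℂ) + Complex.I * ((zval X.2 k : ℤ) : ℂ) := by
  simp [cPoly, coeff_map, coeff_C_mul, coeff_pnPoly]

/-- `cPoly` coefficients vanish beyond the lengths. [cite: FitznerVanDerHofstad2016NoBLE, §5.1.1 (5.4)–(5.5) pp. 1089–1090] -/
theorem coeff_cPoly_eq_zero {X : GZ} {A k : ℕ} (hX : GZle X A) (hk : A ≤ k) : (cPoly X).coeff k = 0 := by
  obtain ⟨h1, h2, h3, h4⟩ := hX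
  rw [coeff_cPoly, zval_eq_zero_of_le (h1.trans hk) (h2.trans hk), zval_eq_zero_of_le (h3.trans hk) (h4.trans hk)]
  simp

/-- Evaluation of `cPoly` at a real point. [cite: FitznerVanDerHofstad2016NoBLE, §5.1.1 (5.4)–(5.5) pp. 1089–1090] -/
theorem eval_cPoly (X : GZ) (w : ℝ) :
    (cPoly X).eval (w : ℂ) = (((pnPoly X.1).eval w : ℝ) : ℂ) + Complex.I * (((pnPoly X.2).eval w : ℝ) : ℂ) := by
  simp only [cPoly, eval_add, eval_mul, eval_C, eval_map]
  rw [show (w : ℂ) = Complex.ofRealHom w from rfl, eval₂_at_apply, eval₂_at_apply]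
  rfl

/-- **`gzMulW` multiplies the complex polynomials** when the output length accommodates the product.
[cite: FitznerVanDerHofstad2016NoBLE, §5.1.1 (5.4)–(5.5) pp. 1089–1090] -/
theorem cPoly_gzMulW (L A B : ℕ) (X Y : GZ) (hX : GZle X A) (hY : GZle Y B) (hAL : A ≤ L)
    (hBL : B ≤ L) (hL : A + B ≤ L + 1) : cPoly (gzMulW L X Y) = cPoly X * cPoly Y := by
  refine Polynomial.ext fun k => ?_
  rw [coeff_cPoly, coeff_mul]
  by_cases hk : k < L
  · obtain ⟨hx1, hx2, hx3, hx4⟩ := hX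
    obtain ⟨hy1, hy2, hy3, hy4⟩ := hY
    rw [zval_gzMulW_re L X Y (hx1.trans hAL) (hx2.trans hAL) (hx3.trans hAL) (hx4.trans hAL)
        (hy1.trans hBL) (hy2.trans hBL) (hy3.trans hBL) (hy4.trans hBL) k hk,
      zval_gzMulW_im L X Y (hx1.trans hAL) (hx2.trans hAL) (hx3.trans hAL) (hx4.trans hAL)
        (hy1.trans hBL) (hy2.trans hBL) (hy3.trans hBL) (hy4.trans hBL) k hk,
      prodReW, prodIm, Finset.Nat.sum_antidiagonal_eq_sum_range_succ_mk]
    simp only [coeff_cPoly]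
    have hsum : ∀ i ∈ Finset.range (k + 1),
        (((zval X.1 i : ℤ) : ℂ) + Complex.I * ((zval X.2 i : ℤ) : ℂ))
          * (((zval Y.1 (k - i) : ℤ) : ℂ) + Complex.I * ((zval Y.2 (k - i) : ℤ) : ℂ))
        = (((zval X.1 i * zval Y.1 (k - i) : ℤ) : ℂ) - ((zval X.2 i * zval Y.2 (k - i) : ℤ) : ℂ))
          + Complex.I * (((zval X.1 i * zval Y.2 (k - i) : ℤ) : ℂ) + ((zval X.2 i * zval Y.1 (k - i) : ℤ) : ℂ)) := by
      intro i _
      push_cast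
      have hI : Complex.I * Complex.I = -1 := Complex.I_mul_I
      linear_combination (((zval X.2 i : ℤ) : ℂ) * ((zval Y.2 (k - i) : ℤ) : ℂ)) * hI
    rw [sum_congr rfl hsum, sum_add_distrib, sum_sub_distrib, ← mul_sum, sum_add_distrib]
    push_cast
    ring
  · rw [not_lt] at hk
    obtain ⟨e1, e2, e3, e4⟩ := gzMulW_len L X Y
    rw [zval_eq_zero_of_le (by omega) (by omega), zval_eq_zero_of_le (by omega) (by omega)]
    push_cast
    rw [mul_zero, zero_add]
    symm
    refine sum_eq_zero fun ij hij => ?_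
    rw [Finset.mem_antidiagonal] at hij
    rcases Nat.lt_or_ge ij.1 A with h | h
    · rw [coeff_cPoly_eq_zero hY (by omega), mul_zero]
    · rw [coeff_cPoly_eq_zero hX h, zero_mul]

/-- **Binary powering of `w`-polynomials**: `cPoly (gzPowWAux ℓ X fuel p) = (cPoly X)^p` with lengths
`≤ p(ℓ-1)+1` (`1 ≤ p ≤ fuel + 1`, `X` of lengths `≤ ℓ`, `ℓ ≥ 1`). [cite: FitznerVanDerHofstad2016NoBLE, §5.1.1 (5.4)–(5.5) pp. 1089–1090] -/
theorem cPoly_gzPowWAux (ℓ : ℕ) (hℓ : 1 ≤ ℓ) (X : GZ) (hX : GZle X ℓ) :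
    ∀ fuel p : ℕ, 1 ≤ p → p ≤ fuel + 1 →
      cPoly (gzPowWAux ℓ X fuel p) = cPoly X ^ p ∧ GZle (gzPowWAux ℓ X fuel p) (p * (ℓ - 1) + 1)
  | 0, p, h1, h2 => by
      obtain rfl : p = 1 := by omega
      rw [gzPowWAux, pow_one, one_mul, Nat.sub_add_cancel hℓ]
      exact ⟨rfl, hX⟩
  | fuel + 1, p, h1, h2 => by
      rw [gzPowWAux]
      cases hb : Nat.ble p 1 with
      | true =>
          obtain rfl : p = 1 := by have := Nat.le_of_ble_eq_true hb; omega
          rw [pow_one, one_mul, Nat.sub_add_cancel hℓ]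
          exact ⟨rfl, hX⟩
      | false =>
          have hp : ¬ p ≤ 1 := fun h => by rw [Nat.ble_eq_true_of_le h] at hb; exact Bool.noConfusion hb
          set m := ℓ - 1 with hm
          by_cases he : p % 2 = 0
          · have hbeq : (p % 2 == 0) = true := by simp [he]
            rw [hbeq]
            obtain ⟨hH, hlen⟩ := cPoly_gzPowWAux ℓ hℓ X hX fuel (p / 2) (by omega) (by omega)
            have h2m : 2 * ((p / 2) * m) ≤ p * m := by
              rw [← mul_assoc]; exact Nat.mul_le_mul_right m (by omega)
            refine ⟨?_, GZle.of_len (gzMulW_len _ _ _)⟩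
            simp only [cond_true, cond_false]
            rw [cPoly_gzMulW (p * m + 1) ((p / 2) * m + 1) ((p / 2) * m + 1) _ _ hlen hlen (by omega) (by omega)
              (by omega), hH, ← pow_add, show p / 2 + p / 2 = p by omega]
          · have hbeq : (p % 2 == 0) = false := by simp [he]
            rw [hbeq]
            obtain ⟨hH, hlen⟩ := cPoly_gzPowWAux ℓ hℓ X hX fuel (p - 1) (by omega) (by omega)
            have hpm : (p - 1) * m + m = p * m := by
              rw [← Nat.succ_mul, Nat.succ_eq_add_one, Nat.sub_add_cancel h1]
            have hXm : GZle X (m + 1) := by rw [hm, Nat.sub_add_cancel hℓ]; exact hX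
            refine ⟨?_, GZle.of_len (gzMulW_len _ _ _)⟩
            simp only [cond_false]
            rw [cPoly_gzMulW (p * m + 1) (m + 1) ((p - 1) * m + 1) _ _ hXm hlen (by omega) (by omega)
              (by omega), hH, ← pow_succ', Nat.sub_add_cancel h1]

/-- **`gzPowW ℓ X p` is `(cPoly X)^p`** with lengths `≤ p(ℓ-1)+1` (`1 ≤ p`). [cite: FitznerVanDerHofstad2016NoBLE, §5.1.1 (5.4)–(5.5) pp. 1089–1090] -/
theorem cPoly_gzPowW (ℓ : ℕ) (hℓ : 1 ≤ ℓ) (X : GZ) (hX : GZle X ℓ) (p : ℕ) (hp : 1 ≤ p) :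
    cPoly (gzPowW ℓ X p) = cPoly X ^ p ∧ GZle (gzPowW ℓ X p) (p * (ℓ - 1) + 1) :=
  cPoly_gzPowWAux ℓ hℓ X hX p p hp (by omega)

/-- **`powN ℓ u p` is `(toPolyN u)^p`** with length `≤ p(ℓ-1)+1` (`u` of length `≤ ℓ`, `ℓ ≥ 1`).
[cite: FitznerVanDerHofstad2016NoBLE, §5.1.1 (5.4)–(5.5) pp. 1089–1090] -/
theorem toPolyN_powN (ℓ : ℕ) (hℓ : 1 ≤ ℓ) (u : List ℕ) (hu : u.length ≤ ℓ) :
    ∀ p : ℕ, toPolyN (powN ℓ u p) = toPolyN u ^ p ∧ (powN ℓ u p).length ≤ p * (ℓ - 1) + 1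
  | 0 => by simp [powN]
  | p + 1 => by
      obtain ⟨hv, hlen⟩ := toPolyN_powN ℓ hℓ u hu p
      set m := ℓ - 1 with hm
      have hum : u.length ≤ m + 1 := by rw [hm, Nat.sub_add_cancel hℓ]; exact hu
      rw [powN, forceN_eq]
      refine ⟨?_, (length_pconv _ _ _).le⟩
      refine Polynomial.ext fun k => ?_
      rw [coeff_toPolyN, pow_succ', coeff_mul, ← hv]
      by_cases hk : k < (p + 1) * m + 1
      · rw [getD_pconv _ u _ (by nlinarith) (by nlinarith) k hk, Finset.Nat.sum_antidiagonal_eq_sum_range_succ_mk]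
        push_cast
        simp only [coeff_toPolyN]
      · rw [not_lt] at hk
        rw [List.getD_eq_getElem?_getD, List.getElem?_eq_none_iff.mpr (by rw [length_pconv]; exact hk)]
        simp only [Option.getD_none, Nat.cast_zero]
        symm
        refine sum_eq_zero fun ij hij => ?_
        rw [Finset.mem_antidiagonal] at hij
        rcases Nat.lt_or_ge ij.1 (m + 1) with h | h
        · have h2 : p * m + 1 ≤ ij.2 := by nlinarith
          rw [mul_comm, coeff_toPolyN u, coeff_toPolyN, List.getD_eq_getElem?_getD (l := powN ℓ u p),
            List.getElem?_eq_none_iff.mpr (hlen.trans h2)]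
          simp
        · rw [coeff_toPolyN, List.getD_eq_getElem?_getD, List.getElem?_eq_none_iff.mpr (hum.trans h)]
          simp

/-! #### The complex main polynomial `P(w)`: `wTermGZ`, `gzP`, `midListZ` -/

/-- `zval (pnOfZ zs) k = zs_k`. [cite: FitznerVanDerHofstad2016NoBLE, §5.1.1 (5.4)–(5.5) pp. 1089–1090] -/
theorem zval_pnOfZ : ∀ (zs : List ℤ) (k : ℕ), zval (pnOfZ zs) k = zs.getD k 0
  | [], k => by simp [zval, pnOfZ, posOfZ, negOfZ]
  | z :: zs, 0 => by
      cases z with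
      | ofNat a => simp only [pnOfZ, posOfZ, negOfZ, zval, List.getD_cons_zero]; simp
      | negSucc a =>
          simp only [pnOfZ, posOfZ, negOfZ, zval, List.getD_cons_zero]
          rw [Int.negSucc_eq]; push_cast; ring
  | z :: zs, k + 1 => by
      have ih := zval_pnOfZ zs k
      simp only [pnOfZ, zval] at ih
      cases z with
      | ofNat a => simp only [pnOfZ, posOfZ, negOfZ, zval, List.getD_cons_succ]; exact ih
      | negSucc a => simp only [pnOfZ, posOfZ, negOfZ, zval, List.getD_cons_succ]; exact ih

/-- `posOfZ` keeps the length. [cite: FitznerVanDerHofstad2016NoBLE, §5.1.1 (5.4)–(5.5) pp. 1089–1090] -/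
theorem length_posOfZ : ∀ zs : List ℤ, (posOfZ zs).length = zs.length
  | [] => rfl
  | (Int.ofNat _) :: zs => by simp only [posOfZ, List.length_cons, length_posOfZ zs]
  | (Int.negSucc _) :: zs => by simp only [posOfZ, List.length_cons, length_posOfZ zs]

/-- `negOfZ` keeps the length. [cite: FitznerVanDerHofstad2016NoBLE, §5.1.1 (5.4)–(5.5) pp. 1089–1090] -/
theorem length_negOfZ : ∀ zs : List ℤ, (negOfZ zs).length = zs.length
  | [] => rfl
  | (Int.ofNat _) :: zs => by simp only [negOfZ, List.length_cons, length_negOfZ zs]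
  | (Int.negSucc _) :: zs => by simp only [negOfZ, List.length_cons, length_negOfZ zs]

/-- `smulPN` scales the value. [cite: FitznerVanDerHofstad2016NoBLE, §5.1.1 (5.4)–(5.5) pp. 1089–1090] -/
theorem zval_smulPN (c : ℕ) (P : List ℕ × List ℕ) (k : ℕ) : zval (smulPN c P) k = (c : ℤ) * zval P k := by
  simp only [zval, smulPN, getD_smulN]; push_cast; ring

/-- `negPN` negates the value. [cite: FitznerVanDerHofstad2016NoBLE, §5.1.1 (5.4)–(5.5) pp. 1089–1090] -/
theorem zval_negPN (P : List ℕ × List ℕ) (k : ℕ) : zval (negPN P) k = -zval P k := by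
  simp [zval, negPN]

/-- `zeroPN` has value `0`. [cite: FitznerVanDerHofstad2016NoBLE, §5.1.1 (5.4)–(5.5) pp. 1089–1090] -/
theorem zval_zeroPN (ℓ k : ℕ) : zval (zeroPN ℓ) k = 0 := by
  simp [zval, zeroPN]

/-- `gzAdd` keeps `GZle`. [cite: FitznerVanDerHofstad2016NoBLE, §5.1.1 (5.4)–(5.5) pp. 1089–1090] -/
theorem gzAdd_le {X Y : GZ} {L : ℕ} (hX : GZle X L) (hY : GZle Y L) : GZle (gzAdd X Y) L := by
  obtain ⟨a1, a2⟩ := length_addPN X.1 Y.1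
  obtain ⟨b1, b2⟩ := length_addPN X.2 Y.2
  obtain ⟨x1, x2, x3, x4⟩ := hX
  obtain ⟨y1, y2, y3, y4⟩ := hY
  unfold GZle gzAdd
  dsimp only
  rw [a1, a2, b1, b2]
  exact ⟨max_le x1 y1, max_le x2 y2, max_le x3 y3, max_le x4 y4⟩

/-- `gzSum` keeps `GZle` (summands `j < n`). [cite: FitznerVanDerHofstad2016NoBLE, §5.1.1 (5.4)–(5.5) pp. 1089–1090] -/
theorem gzSum_le (f : ℕ → GZ) (L : ℕ) : ∀ (n : ℕ) (acc : GZ),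
    (∀ j, j < n → GZle (f j) L) → GZle acc L → GZle (gzSum f n acc) L
  | 0, acc, _, hacc => hacc
  | n + 1, acc, hf, hacc => by
      rw [gzSum]
      exact gzSum_le f L n _ (fun j hj => hf j (by omega)) (gzAdd_le (hf n (by omega)) hacc)

/-- Length of the padded scaled main list. [cite: FitznerVanDerHofstad2016NoBLE, §5.1.1 (5.4)–(5.5) pp. 1089–1090] -/
theorem length_midListZ (a J S ℓ : ℕ) (h : blen a J ≤ ℓ) : (midListZ a J S ℓ).length = ℓ := by
  simp only [midListZ, midList, List.length_append, List.length_map, List.length_range,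
    List.length_replicate]
  omega

/-- Lengths of `wTermGZ j` are `≤ ℓ`. [cite: FitznerVanDerHofstad2016NoBLE, §5.1.1 (5.4)–(5.5) pp. 1089–1090] -/
theorem wTermGZ_le (Jb S ℓ m : ℕ) (Q : ℕ → ℤ) (j : ℕ) (hℓ : blen (j * m) Jb ≤ ℓ) :
    GZle (wTermGZ Jb S ℓ m Q j) ℓ := by
  have hz : (midListZ (j * m) Jb S ℓ).length = ℓ := length_midListZ _ _ _ _ hℓ
  have hb1 : ∀ c, (smulPN c (pnOfZ (midListZ (j * m) Jb S ℓ))).1.length = ℓ := fun c => by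
    simp [smulPN, pnOfZ, length_smulN, length_posOfZ, hz]
  have hb2 : ∀ c, (smulPN c (pnOfZ (midListZ (j * m) Jb S ℓ))).2.length = ℓ := fun c => by
    simp [smulPN, pnOfZ, length_smulN, length_negOfZ, hz]
  unfold wTermGZ GZle
  split_ifs <;> cases (xor (decide (Q j < 0)) (decide (2 ≤ j % 4))) <;>
    simp [negPN, hb1, hb2, zeroPN]

/-- Lengths of `gzP` are `≤ ℓ` when `ℓ` accommodates every `Mid_{jm}`, `j ≤ J`.
[cite: FitznerVanDerHofstad2016NoBLE, §5.1.1 (5.4)–(5.5) pp. 1089–1090] -/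
theorem gzP_le (Jb S ℓ m J : ℕ) (Q : ℕ → ℤ) (hℓ : ∀ j, j ≤ J → blen (j * m) Jb ≤ ℓ) :
    GZle (gzP Jb S ℓ m J Q) ℓ := by
  have hs : GZle (gzSum (wTermGZ Jb S ℓ m Q) (J + 1) (zeroPN ℓ, zeroPN ℓ)) ℓ :=
    gzSum_le _ ℓ (J + 1) _ (fun j hj => wTermGZ_le Jb S ℓ m Q j (hℓ j (by omega)))
      ⟨by simp [zeroPN], by simp [zeroPN], by simp [zeroPN], by simp [zeroPN]⟩
  obtain ⟨h1, h2, h3, h4⟩ := hs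
  obtain ⟨n1, n2⟩ := length_normPN (gzSum (wTermGZ Jb S ℓ m Q) (J + 1) (zeroPN ℓ, zeroPN ℓ)).1
  obtain ⟨n3, n4⟩ := length_normPN (gzSum (wTermGZ Jb S ℓ m Q) (J + 1) (zeroPN ℓ, zeroPN ℓ)).2
  unfold gzP GZle
  simp only [forcePN_eq]
  rw [n1, n2, n3, n4]
  exact ⟨max_le h1 h2, max_le h1 h2, max_le h3 h4, max_le h3 h4⟩

/-- **Values of `wTermGZ j`**: real part `reSign j · ε_j Q_j · (2^S Mid_{jm})_k`, imaginary part
`imSign j · ε_j Q_j · (2^S Mid_{jm})_k`. [cite: FitznerVanDerHofstad2016NoBLE, §5.1.1 (5.4)–(5.5) pp. 1089–1090] -/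
theorem zval_wTermGZ (Jb S ℓ m : ℕ) (Q : ℕ → ℤ) (j k : ℕ) :
    zval (wTermGZ Jb S ℓ m Q j).1 k
        = reSign j * ((epsN j : ℤ) * Q j) * (midListZ (j * m) Jb S ℓ).getD k 0 ∧
      zval (wTermGZ Jb S ℓ m Q j).2 k
        = imSign j * ((epsN j : ℤ) * Q j) * (midListZ (j * m) Jb S ℓ).getD k 0 := by
  have key : ∀ b : Bool, zval (bif b then
        negPN (smulPN ((if j = 0 then 1 else 2) * (Q j).natAbs) (pnOfZ (midListZ (j * m) Jb S ℓ)))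
      else smulPN ((if j = 0 then 1 else 2) * (Q j).natAbs) (pnOfZ (midListZ (j * m) Jb S ℓ))) k
      = (if b then -1 else 1) * (((if j = 0 then 1 else 2) * (Q j).natAbs : ℕ) : ℤ)
          * (midListZ (j * m) Jb S ℓ).getD k 0 := by
    intro b
    cases b <;> simp only [Bool.false_eq_true, if_true, if_false, cond_true,
      cond_false, zval_negPN, zval_smulPN, zval_pnOfZ] <;> ring
  have hrt : ∀ s : ℤ, (if xor (decide (Q j < 0)) (decide (2 ≤ j % 4)) then -1 else 1)
      * (((if j = 0 then 1 else 2) * (Q j).natAbs : ℕ) : ℤ) * s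
      = (if 2 ≤ j % 4 then -1 else 1) * ((epsN j : ℤ) * Q j) * s := by
    intro s
    have := rtSign_mul_cabs Q j (epsN j)
    unfold rtSign epsN at this
    unfold epsN
    rw [this]; ring
  unfold wTermGZ
  by_cases hj : j % 2 = 0
  · simp only [hj, if_true]
    refine ⟨?_, ?_⟩
    · rw [key, hrt]; unfold reSign; rw [if_pos hj]
    · rw [zval_zeroPN]; unfold imSign; rw [if_pos hj]; simp
  · simp only [hj, if_false]
    refine ⟨?_, ?_⟩
    · rw [zval_zeroPN]; unfold reSign; rw [if_neg hj]; simp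
    · rw [key, hrt]; unfold imSign; rw [if_neg hj]

/-- **Coefficients of `cPoly (wTermGZ j)`**: `ε_j Q_j i^j · (2^S Mid_{jm})_k`.
[cite: FitznerVanDerHofstad2016NoBLE, §5.1.1 (5.4)–(5.5) pp. 1089–1090] -/
theorem coeff_cPoly_wTermGZ (Jb S ℓ m : ℕ) (Q : ℕ → ℤ) (j k : ℕ) :
    (cPoly (wTermGZ Jb S ℓ m Q j)).coeff k
      = ((epsN j : ℂ) * (Q j : ℂ) * Complex.I ^ j) * (((midListZ (j * m) Jb S ℓ).getD k 0 : ℤ) : ℂ) := by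
  obtain ⟨h1, h2⟩ := zval_wTermGZ Jb S ℓ m Q j k
  rw [coeff_cPoly, h1, h2, I_pow_eq]
  push_cast
  ring

/-- **`gzP` is `Σ_{j ≤ J} ε_j Q_j i^j · (2^S Mid_{jm})(w)`** as a complex polynomial.
[cite: FitznerVanDerHofstad2016NoBLE, §5.1.1 (5.4)–(5.5) pp. 1089–1090] -/
theorem cPoly_gzP (Jb S ℓ m J : ℕ) (Q : ℕ → ℤ) :
    cPoly (gzP Jb S ℓ m J Q) = ∑ j ∈ range (J + 1),
      C ((epsN j : ℂ) * (Q j : ℂ) * Complex.I ^ j)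
        * (toPolyZ (midListZ (j * m) Jb S ℓ)).map Complex.ofRealHom := by
  refine Polynomial.ext fun k => ?_
  obtain ⟨h1, h2⟩ := zval_gzSum (wTermGZ Jb S ℓ m Q) k (J + 1) (zeroPN ℓ, zeroPN ℓ)
  rw [coeff_cPoly, finsetSum_coeff]
  unfold gzP
  simp only [forcePN_eq, zval_normPN]
  rw [h1, h2, zval_zeroPN, zero_add, zero_add]
  push_cast
  rw [mul_sum, ← sum_add_distrib]
  refine sum_congr rfl fun j _ => ?_
  rw [← coeff_cPoly, coeff_cPoly_wTermGZ, coeff_C_mul, coeff_map, coeff_toPolyZ]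
  simp

/-- `toPolyZ` of a zero list. [cite: FitznerVanDerHofstad2016NoBLE, §5.1.1 (5.4)–(5.5) pp. 1089–1090] -/
theorem toPolyZ_replicate_zero : ∀ n : ℕ, toPolyZ (List.replicate n (0 : ℤ)) = 0
  | 0 => by simp
  | n + 1 => by rw [List.replicate_succ, toPolyZ_cons, toPolyZ_replicate_zero n]; simp

/-- Zero padding does not change `toPolyZ`. [cite: FitznerVanDerHofstad2016NoBLE, §5.1.1 (5.4)–(5.5) pp. 1089–1090] -/
theorem toPolyZ_append_replicate_zero : ∀ (l : List ℤ) (n : ℕ),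
    toPolyZ (l ++ List.replicate n 0) = toPolyZ l
  | [], n => by rw [List.nil_append, toPolyZ_replicate_zero]; simp
  | a :: as, n => by rw [List.cons_append, toPolyZ_cons, toPolyZ_cons, toPolyZ_append_replicate_zero as n]

/-- **The padded scaled main list is `2^S · Mid_a(w)`** (dyadic coefficients).
[cite: FitznerVanDerHofstad2016NoBLE, §5.1.1 (5.4)–(5.5) pp. 1089–1090] -/
theorem toPolyZ_midListZ (a J S ℓ : ℕ) (hdy : ∀ q ∈ midList a J, dyadicOK S q = true) :
    toPolyZ (midListZ a J S ℓ) = C ((2 : ℝ) ^ S) * toPolyQ (midList a J) := by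
  rw [midListZ, toPolyZ_append_replicate_zero, toPolyZ_map_scaleZ S _ hdy]

/-- `Mid_a(w) = Σ_{i<a+J+1} mcoef a J i w^i`. [cite: FitznerVanDerHofstad2016NoBLE, §5.1.1 (5.4)–(5.5) pp. 1089–1090] -/
theorem eval_toPolyQ_midList (a J : ℕ) (w : ℝ) :
    (toPolyQ (midList a J)).eval w = ∑ i ∈ range (a + J + 1), ((mcoef a J i : ℚ) : ℝ) * w ^ i := by
  rw [midList, toPolyQ_range_map_eval]
  have hle : a + J + 1 ≤ blen a J := by unfold blen; omega
  rw [← sum_range_add_sum_Ico _ hle]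
  rw [sum_eq_zero (s := Ico _ _) fun i hi => by
    rw [Finset.mem_Ico] at hi; rw [mcoef_eq_zero (by omega)]; simp, add_zero]

/-- The complex main polynomial `P(w) = Σ_{j ≤ J} ε_j i^j (Q_j/qden) Mid_{jm}(w)`.
[cite: FitznerVanDerHofstad2016NoBLE, §5.1.1 (5.4)–(5.5) pp. 1089–1090] -/
noncomputable def twP (m J Jb : ℕ) (Q : ℕ → ℤ) (qden : ℕ) (w : ℝ) : ℂ :=
  ∑ j ∈ range (J + 1), (epsN j : ℂ) * Complex.I ^ j * ((Q j : ℂ) / (qden : ℂ))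
    * (((toPolyQ (midList (j * m) Jb)).eval w : ℝ) : ℂ)

/-- **`cPoly (gzP …)` evaluates to `2^S · qden · P(w)`** (dyadic main lists, `qden > 0`).
[cite: FitznerVanDerHofstad2016NoBLE, §5.1.1 (5.4)–(5.5) pp. 1089–1090] -/
theorem eval_cPoly_gzP (Jb S ℓ m J : ℕ) (Q : ℕ → ℤ) (qden : ℕ) (hq : 0 < qden)
    (hdy : ∀ j, j ≤ J → ∀ q ∈ midList (j * m) Jb, dyadicOK S q = true) (w : ℝ) :
    (cPoly (gzP Jb S ℓ m J Q)).eval (w : ℂ) = ((2 : ℂ) ^ S * (qden : ℂ)) * twP m J Jb Q qden w := by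
  rw [cPoly_gzP, eval_finsetSum, twP, mul_sum]
  refine sum_congr rfl fun j hj => ?_
  have hjJ : j ≤ J := by have := mem_range.mp hj; omega
  rw [eval_mul, eval_C, eval_map, show (w : ℂ) = Complex.ofRealHom w from rfl, eval₂_at_apply,
    toPolyZ_midListZ _ _ _ _ (hdy j hjJ), eval_mul, eval_C]
  have hq0 : (qden : ℂ) ≠ 0 := by exact_mod_cast hq.ne'
  field_simp
  simp only [Complex.ofRealHom_eq_coe, Complex.ofReal_mul, Complex.ofReal_pow, Complex.ofReal_ofNat]
  ring

/-- **The certificate's `powRe` is `Re((2^S qden P(w))^D)`**: for `1 ≤ D`, dyadic main lists and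
`lw ≥ blen (jm) Jb` (`j ≤ J`), `(pnPoly (c.powRe D)).eval w = (2^S qden)^D · Re(P(w)^D)`.
[cite: FitznerVanDerHofstad2016NoBLE, §5.1.1 (5.4)–(5.5) pp. 1089–1090] -/
theorem TwCert.powRe_eval (c : TwCert) (D : ℕ) (hD : 1 ≤ D) (hq : 0 < c.qden)
    (hdy : ∀ j, j ≤ c.J → ∀ q ∈ midList (j * c.m) c.Jb, dyadicOK c.S q = true)
    (hℓ : ∀ j, j ≤ c.J → blen (j * c.m) c.Jb ≤ c.lw) (w : ℝ) :
    (pnPoly (c.powRe D)).eval w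
      = ((2 : ℝ) ^ c.S * c.qden) ^ D * ((twP c.m c.J c.Jb c.Q c.qden w) ^ D).re := by
  have hlw : 1 ≤ c.lw := by unfold TwCert.lw blen; omega
  obtain ⟨hpow, -⟩ := cPoly_gzPowW c.lw hlw c.gzPw (gzP_le _ _ _ _ _ _ hℓ) D hD
  have hev := congrArg (fun p : ℂ[X] => (p.eval (w : ℂ)).re) hpow
  rw [eval_cPoly, eval_pow] at hev
  simp only [Complex.add_re, Complex.ofReal_re, Complex.mul_re, Complex.I_re,
    Complex.I_im, Complex.ofReal_im, zero_mul, mul_zero, sub_zero, add_zero] at hev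
  unfold TwCert.powRe
  rw [show (pnPoly (gzPowW c.lw c.gzPw D).1).eval w = ((cPoly c.gzPw).eval (w : ℂ) ^ D).re by
    simpa using hev]
  unfold TwCert.gzPw
  rw [eval_cPoly_gzP _ _ _ _ _ _ _ hq hdy, mul_pow, ← Complex.ofReal_natCast, ← Complex.ofReal_ofNat,
    ← Complex.ofReal_pow, ← Complex.ofReal_mul, ← Complex.ofReal_pow, Complex.re_ofReal_mul]

/-! #### The majorant base lists `majBase` -/

/-- Length of `majBase`. [cite: FitznerVanDerHofstad2016NoBLE, §5.1.1 (5.4)–(5.5) pp. 1089–1090] -/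
theorem length_majBase (Jb S ℓ : ℕ) (eps0 α ρ : ℚ) (c : ℕ) : (majBase Jb S ℓ eps0 α ρ c).length = ℓ := by
  simp [majBase]

/-- A dyadic nonnegative rational scales to a nonnegative integer with the expected real value.
[cite: FitznerVanDerHofstad2016NoBLE, §5.1.1 (5.4)–(5.5) pp. 1089–1090] -/
theorem cast_scaleZ_real {S : ℕ} {q : ℚ} (h : dyadicOK S q = true) :
    ((scaleZ S q : ℤ) : ℝ) = (q : ℝ) * 2 ^ S := by
  have h1 : (((scaleZ S q : ℤ) : ℚ) : ℝ) = ((q * 2 ^ S : ℚ) : ℝ) := by rw [cast_scaleZ h]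
  rw [Rat.cast_intCast] at h1
  rw [h1]; push_cast; ring

/-- See `cast_scaleZ_real`. [cite: FitznerVanDerHofstad2016NoBLE, §5.1.1 (5.4)–(5.5) pp. 1089–1090] -/
theorem scaleZ_nonneg {S : ℕ} {q : ℚ} (h : dyadicOK S q = true) (hq : 0 ≤ q) : 0 ≤ scaleZ S q := by
  have : (0 : ℚ) ≤ ((scaleZ S q : ℤ) : ℚ) := by rw [cast_scaleZ h]; positivity
  exact_mod_cast this

/-- **Entries of `majBase`** (dyadic nonnegative data, `i < ℓ`):
`2^{2S}(α U_i + [i = J_b+1] c ρ)` with `U_i` the `i`-th coefficient of `upList 0 J_b ε_0`.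
[cite: FitznerVanDerHofstad2016NoBLE, §5.1.1 (5.4)–(5.5) pp. 1089–1090] -/
theorem cast_getD_majBase (Jb S ℓ : ℕ) (eps0 α ρ : ℚ) (c : ℕ) (hα : dyadicOK S α = true)
    (hρ : dyadicOK S ρ = true) (hup : ∀ q ∈ upList 0 Jb eps0, dyadicOK S q = true) (hα0 : 0 ≤ α)
    (hρ0 : 0 ≤ ρ) (hup0 : ∀ q ∈ upList 0 Jb eps0, 0 ≤ q) (i : ℕ) (hi : i < ℓ) :
    (((majBase Jb S ℓ eps0 α ρ c).getD i 0 : ℕ) : ℝ)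
      = (2 : ℝ) ^ (2 * S) * ((α : ℝ) * (((upList 0 Jb eps0).getD i 0 : ℚ) : ℝ)
          + (if i = Jb + 1 then (c : ℝ) * (ρ : ℝ) else 0)) := by
  set U := (upList 0 Jb eps0).getD i 0 with hU
  have hUd : dyadicOK S U = true ∧ 0 ≤ U := by
    by_cases hil : i < (upList 0 Jb eps0).length
    · have hmem : U ∈ upList 0 Jb eps0 := by
        rw [hU, List.getD_eq_getElem?_getD, List.getElem?_eq_getElem hil]
        exact List.getElem_mem hil
      exact ⟨hup U hmem, hup0 U hmem⟩
    · have hU0 : U = 0 := by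
        rw [hU, List.getD_eq_getElem?_getD, List.getElem?_eq_none_iff.mpr (not_lt.mp hil)]
        rfl
      rw [hU0]
      exact ⟨by simp [dyadicOK], le_rfl⟩
  have hz : (majBase Jb S ℓ eps0 α ρ c).getD i 0
      = (scaleZ S α * scaleZ S U + (if i = Jb + 1 then (c : ℤ) * scaleZ S ρ * 2 ^ S else 0)).toNat := by
    rw [majBase, List.getD_eq_getElem?_getD, List.getElem?_map, List.getElem?_range hi]
    rfl
  have hnn : 0 ≤ scaleZ S α * scaleZ S U + (if i = Jb + 1 then (c : ℤ) * scaleZ S ρ * 2 ^ S else 0) := by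
    have h1 := scaleZ_nonneg hα hα0
    have h2 := scaleZ_nonneg hUd.1 hUd.2
    have h3 := scaleZ_nonneg hρ hρ0
    split_ifs
    · positivity
    · positivity
  rw [hz]
  have hcast : (((scaleZ S α * scaleZ S U
      + (if i = Jb + 1 then (c : ℤ) * scaleZ S ρ * 2 ^ S else 0)).toNat : ℕ) : ℝ)
      = ((scaleZ S α * scaleZ S U
          + (if i = Jb + 1 then (c : ℤ) * scaleZ S ρ * 2 ^ S else 0) : ℤ) : ℝ) := by
    rw [← Int.cast_natCast, Int.toNat_of_nonneg hnn]
  rw [hcast]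
  push_cast
  rw [cast_scaleZ_real hα, cast_scaleZ_real hUd.1]
  split_ifs with h
  · rw [cast_scaleZ_real hρ]; ring
  · ring

/-- **`majBase` evaluates to `2^{2S}(α U_0(w) + c ρ w^{J_b+1})`** at length `ℓ = blen 0 J_b = J_b + 2`,
where `U_0(w) = (toPolyQ (upList 0 J_b ε_0)).eval w` is the upper bracket polynomial of order `0`.
[cite: FitznerVanDerHofstad2016NoBLE, §5.1.1 (5.4)–(5.5) pp. 1089–1090] -/
theorem eval_toPolyN_majBase (Jb S : ℕ) (eps0 α ρ : ℚ) (c : ℕ) (hα : dyadicOK S α = true)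
    (hρ : dyadicOK S ρ = true) (hup : ∀ q ∈ upList 0 Jb eps0, dyadicOK S q = true) (hα0 : 0 ≤ α)
    (hρ0 : 0 ≤ ρ) (hup0 : ∀ q ∈ upList 0 Jb eps0, 0 ≤ q) (w : ℝ) :
    (toPolyN (majBase Jb S (blen 0 Jb) eps0 α ρ c)).eval w
      = (2 : ℝ) ^ (2 * S) * ((α : ℝ) * (toPolyQ (upList 0 Jb eps0)).eval w
          + (c : ℝ) * (ρ : ℝ) * w ^ (Jb + 1)) := by
  have hlenU : (upList 0 Jb eps0).length = blen 0 Jb := by simp [upList]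
  rw [toPolyN_eval, toPolyQ_eval, length_majBase, hlenU, mul_sum, mul_add, mul_sum]
  have hJ : Jb + 1 < blen 0 Jb := by unfold blen; omega
  rw [show (2 : ℝ) ^ (2 * S) * ((c : ℝ) * (ρ : ℝ) * w ^ (Jb + 1))
      = ∑ i ∈ range (blen 0 Jb), (if i = Jb + 1 then (2 : ℝ) ^ (2 * S) * ((c : ℝ) * (ρ : ℝ)) * w ^ i else 0) by
    rw [sum_ite_eq' (range (blen 0 Jb)) (Jb + 1), if_pos (mem_range.mpr hJ)]; ring]
  rw [← sum_add_distrib]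
  refine sum_congr rfl fun i hi => ?_
  rw [cast_getD_majBase Jb S _ eps0 α ρ c hα hρ hup hα0 hρ0 hup0 i (mem_range.mp hi)]
  split_ifs with h
  · ring
  · ring

/-! #### Exact lengths and the tail power integrals -/

/-- Exact length of `powN`. [cite: FitznerVanDerHofstad2016NoBLE, §5.1.1 (5.4)–(5.5) pp. 1089–1090] -/
theorem length_powN (ℓ : ℕ) (u : List ℕ) : ∀ p : ℕ, (powN ℓ u p).length = p * (ℓ - 1) + 1
  | 0 => by simp [powN]
  | p + 1 => by rw [powN, forceN_eq, length_pconv]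

/-- Exact lengths of `gzPowW ℓ X p` for `p ≥ 2` (the last step is a `gzMulW`).
[cite: FitznerVanDerHofstad2016NoBLE, §5.1.1 (5.4)–(5.5) pp. 1089–1090] -/
theorem gzPowW_len (ℓ : ℕ) (X : GZ) (p : ℕ) (hp : 2 ≤ p) : GZlen (gzPowW ℓ X p) (p * (ℓ - 1) + 1) := by
  obtain ⟨f, rfl⟩ : ∃ f, p = f + 1 := ⟨p - 1, by omega⟩
  rw [gzPowW, gzPowWAux]
  have hb : Nat.ble (f + 1) 1 = false := by
    cases h : Nat.ble (f + 1) 1 with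
    | false => rfl
    | true => have := Nat.le_of_ble_eq_true h; omega
  rw [hb]
  cases (f + 1) % 2 == 0 with
  | true => exact gzMulW_len _ _ _
  | false => exact gzMulW_len _ _ _

/-- `(√u)^D = u^{D/2}` (`u ≥ 0`). [cite: FitznerVanDerHofstad2016NoBLE, §5.1.1 (5.4)–(5.5) pp. 1089–1090] -/
theorem sqrt_pow_eq_rpowT {u : ℝ} (hu : 0 ≤ u) (D : ℕ) : (√u) ^ D = u ^ ((D : ℝ) / 2) := by
  rw [Real.sqrt_eq_rpow, ← Real.rpow_natCast, ← Real.rpow_mul hu]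
  congr 1; ring

/-- `u^{n'} (1/u)^i/(√u)^D = u^{n' - D/2 - i}` (`u > 0`). [cite: FitznerVanDerHofstad2016NoBLE, §5.1.1 (5.4)–(5.5) pp. 1089–1090] -/
theorem rpow_combineT {u : ℝ} (hu : 0 < u) (D n' i : ℕ) :
    u ^ n' / (√u) ^ D * (1 / u) ^ i = u ^ ((n' : ℝ) - D / 2 - i) := by
  rw [sqrt_pow_eq_rpowT hu.le,
    show (n' : ℝ) - D / 2 - i = (n' : ℝ) + (-((D : ℝ) / 2)) + (-(i : ℝ)) by ring,
    Real.rpow_add hu, Real.rpow_add hu, Real.rpow_neg hu.le, Real.rpow_neg hu.le,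
    Real.rpow_natCast, Real.rpow_natCast, one_div, inv_pow]
  ring

/-- `∫_{t²}^∞ u^{n' - D/2 - i} du = 2/((D - 2n' - 2 + 2i) t^{D - 2n' - 2 + 2i})` (`2n' + 3 ≤ D`, `t > 0`).
[cite: FitznerVanDerHofstad2016NoBLE, §5.1.1 (5.4)–(5.5) pp. 1089–1090] -/
theorem integral_rpow_tailT {t : ℝ} (ht : 0 < t) {D n' : ℕ} (hd : 2 * n' + 3 ≤ D) (i : ℕ) :
    ∫ u in Ioi (t ^ 2), u ^ ((n' : ℝ) - D / 2 - i)
      = 2 / ((((D - 2 * (n' + 1) + 2 * i : ℕ) : ℝ)) * t ^ (D - 2 * (n' + 1) + 2 * i)) := by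
  have hnD : 2 * (n' : ℝ) + 3 ≤ (D : ℝ) := by exact_mod_cast hd
  have hi0 : (0 : ℝ) ≤ i := Nat.cast_nonneg i
  have ha : (n' : ℝ) - D / 2 - i < -1 := by linarith
  rw [integral_Ioi_rpow_of_lt ha (by positivity)]
  have hk : ((D - 2 * (n' + 1) + 2 * i : ℕ) : ℝ) = (D : ℝ) - 2 * ((n' : ℝ) + 1) + 2 * i := by
    rw [Nat.cast_add, Nat.cast_sub (by omega)]; push_cast; ring
  have e1 : (t ^ 2) ^ ((n' : ℝ) - D / 2 - i + 1) = (t ^ (D - 2 * (n' + 1) + 2 * i))⁻¹ := by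
    rw [← Real.rpow_two, ← Real.rpow_mul ht.le,
      show (2 : ℝ) * ((n' : ℝ) - D / 2 - i + 1) = -(((D - 2 * (n' + 1) + 2 * i : ℕ) : ℝ)) by
        rw [hk]; ring,
      Real.rpow_neg ht.le, Real.rpow_natCast]
  rw [e1, hk, show (n' : ℝ) - D / 2 - i + 1 = -(((D : ℝ) - 2 * ((n' : ℝ) + 1) + 2 * i) / 2) by ring]
  have hne' : (D : ℝ) - 2 * ((n' : ℝ) + 1) + 2 * i ≠ 0 := by linarith
  have htk : t ^ (D - 2 * (n' + 1) + 2 * i) ≠ 0 := pow_ne_zero _ ht.ne'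
  field_simp

/-- `pnPoly pl` evaluates to `Σ_{i<len} (pl⁺_i - pl⁻_i) w^i` (equal lengths).
[cite: FitznerVanDerHofstad2016NoBLE, §5.1.1 (5.4)–(5.5) pp. 1089–1090] -/
theorem eval_pnPoly_eq_sum (pl : List ℕ × List ℕ) (hl : pl.1.length = pl.2.length) (w : ℝ) :
    (pnPoly pl).eval w = ∑ i ∈ range pl.1.length,
      (((pl.1.getD i 0 : ℕ) : ℝ) - ((pl.2.getD i 0 : ℕ) : ℝ)) * w ^ i := by
  rw [pnPoly, eval_sub, toPolyN_eval, toPolyN_eval, ← hl, ← sum_sub_distrib]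
  refine sum_congr rfl fun i _ => by ring

/-- **The tail integral of a coefficient-list polynomial**: for equal lengths, `2n'+3 ≤ D`, `t > 0`,
`∫_{t²}^∞ u^{n'}/(√u)^D · pnPoly pl (1/u) du = tailInt t pl (D - 2(n'+1))`, and the integrand is integrable.
[cite: FitznerVanDerHofstad2016NoBLE, §5.1.1 (5.4)–(5.5) pp. 1089–1090] -/
theorem integral_tailPoly {t : ℕ} (ht : 0 < t) {D n' : ℕ} (hd : 2 * n' + 3 ≤ D)
    (pl : List ℕ × List ℕ) (hl : pl.1.length = pl.2.length) :
    IntegrableOn (fun u : ℝ => u ^ n' / (√u) ^ D * (pnPoly pl).eval (1 / u)) (Ioi ((t : ℝ) ^ 2)) ∧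
    ∫ u in Ioi ((t : ℝ) ^ 2), u ^ n' / (√u) ^ D * (pnPoly pl).eval (1 / u)
      = ((tailInt t pl (D - 2 * (n' + 1)) : ℚ) : ℝ) := by
  have htr : (0 : ℝ) < (t : ℝ) := by exact_mod_cast ht
  have hT0 : (0 : ℝ) < (t : ℝ) ^ 2 := by positivity
  have hnD : 2 * (n' : ℝ) + 3 ≤ (D : ℝ) := by exact_mod_cast hd
  set cf : ℕ → ℝ := fun i => ((pl.1.getD i 0 : ℕ) : ℝ) - ((pl.2.getD i 0 : ℕ) : ℝ) with hcf
  set f : ℝ → ℝ := fun u => ∑ i ∈ range pl.1.length, cf i * u ^ ((n' : ℝ) - D / 2 - i) with hf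
  have hf_eq : ∀ u ∈ Ioi ((t : ℝ) ^ 2), u ^ n' / (√u) ^ D * (pnPoly pl).eval (1 / u) = f u := by
    intro u hu
    have hu0 : 0 < u := hT0.trans hu
    rw [hf, eval_pnPoly_eq_sum pl hl, mul_sum]
    refine sum_congr rfl fun i _ => ?_
    rw [hcf, ← rpow_combineT hu0 D n' i]
    ring
  have hintpow : ∀ i : ℕ, IntegrableOn (fun u : ℝ => u ^ ((n' : ℝ) - D / 2 - i)) (Ioi ((t : ℝ) ^ 2)) := by
    intro i
    have hi0 : (0 : ℝ) ≤ i := Nat.cast_nonneg i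
    exact integrableOn_Ioi_rpow_of_lt (by linarith) hT0
  have hf_int : IntegrableOn f (Ioi ((t : ℝ) ^ 2)) := by
    rw [hf]
    refine integrable_finsetSum _ fun i _ => ?_
    exact (hintpow i).const_mul _
  refine ⟨hf_int.congr_fun (fun u hu => (hf_eq u hu).symm) measurableSet_Ioi, ?_⟩
  rw [setIntegral_congr_fun measurableSet_Ioi hf_eq, hf,
    integral_finsetSum _ (fun i _ => (hintpow i).const_mul _)]
  simp_rw [integral_const_mul, integral_rpow_tailT htr hd]
  rw [tailInt_eq _ _ _ hl]
  push_cast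
  refine sum_congr rfl fun i _ => ?_
  rw [hcf]
  ring

/-! #### Pointwise brackets on `[T,∞)` -/

/-- `F(u) = Σ_j ε_j i^j (Q_j/qden) √(2πu) q_u(jm)` (`= √(2πu) Ψ(u)`). [cite: FitznerVanDerHofstad2016NoBLE, §5.1.1 (5.4)–(5.5) pp. 1089–1090] -/
noncomputable def twF (m J : ℕ) (Q : ℕ → ℤ) (qden : ℕ) (u : ℝ) : ℂ :=
  ∑ j ∈ range (J + 1), (epsN j : ℂ) * Complex.I ^ j * ((Q j : ℂ) / (qden : ℂ))
    * ((√(2 * π * u) * srwHeatKernel u ((j * m : ℕ) : ℤ) : ℝ) : ℂ)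

/-- `F = √(2πu) Ψ`. [cite: FitznerVanDerHofstad2016NoBLE, §5.1.1 (5.4)–(5.5) pp. 1089–1090] -/
theorem twF_eq (m J : ℕ) (Q : ℕ → ℤ) (qden : ℕ) (u : ℝ) :
    twF m J Q qden u = ((√(2 * π * u) : ℝ) : ℂ) * twPsi m J Q qden u := by
  rw [twF, twPsi, mul_sum]
  refine sum_congr rfl fun j _ => ?_
  push_cast
  ring

/-- **The `[T,∞)` integrand identity**: `u^{n'} Re Ψ(u)^D = (2π)^{-D/2} · u^{n'}/(√u)^D · Re F(u)^D` (`u > 0`).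
[cite: FitznerVanDerHofstad2016NoBLE, §5.1.1 (5.4)–(5.5) pp. 1089–1090] -/
theorem integrand_eqT (m J : ℕ) (Q : ℕ → ℤ) (qden : ℕ) (D n' : ℕ) {u : ℝ} (hu : 0 < u) :
    u ^ n' * (twPsi m J Q qden u ^ D).re
      = ((√(2 * π)) ^ D)⁻¹ * (u ^ n' / (√u) ^ D) * (twF m J Q qden u ^ D).re := by
  have hs : √(2 * π * u) = √(2 * π) * √u := by rw [Real.sqrt_mul (by positivity)]
  have hs0 : 0 < √(2 * π * u) := Real.sqrt_pos.mpr (by positivity)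
  have hΨ : twPsi m J Q qden u = (((√(2 * π * u))⁻¹ : ℝ) : ℂ) * twF m J Q qden u := by
    rw [twF_eq, ← mul_assoc, ← Complex.ofReal_mul, inv_mul_cancel₀ hs0.ne', Complex.ofReal_one, one_mul]
  rw [hΨ, mul_pow, ← Complex.ofReal_pow, Complex.re_ofReal_mul, hs, inv_pow, mul_pow]
  have h1 : (√(2 * π)) ^ D ≠ 0 := pow_ne_zero _ (Real.sqrt_pos.mpr (by positivity)).ne'
  have h2 : (√u) ^ D ≠ 0 := pow_ne_zero _ (Real.sqrt_pos.mpr hu).ne'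
  field_simp

/-- Norm of `F(u) - P(w)` from termwise brackets. [cite: FitznerVanDerHofstad2016NoBLE, §5.1.1 (5.4)–(5.5) pp. 1089–1090] -/
theorem norm_twF_sub_twP_le (m J Jb : ℕ) (Q : ℕ → ℤ) (qden : ℕ) (u w : ℝ) (e : ℕ → ℝ)
    (he : ∀ j, j ≤ J → |√(2 * π * u) * srwHeatKernel u ((j * m : ℕ) : ℤ)
      - (toPolyQ (midList (j * m) Jb)).eval w| ≤ e j) :
    ‖twF m J Q qden u - twP m J Jb Q qden w‖
      ≤ ∑ j ∈ range (J + 1), (epsN j : ℝ) * (|(Q j : ℝ)| / qden) * e j := by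
  rw [twF, twP, ← sum_sub_distrib]
  refine (norm_sum_le _ _).trans (sum_le_sum fun j hj => ?_)
  rw [Finset.mem_range] at hj
  rw [← mul_sub, ← Complex.ofReal_sub, norm_mul, norm_mul, norm_mul, Complex.norm_natCast, norm_pow,
    Complex.norm_I, one_pow, mul_one, Complex.norm_real, Real.norm_eq_abs, norm_div, Complex.norm_intCast,
    Complex.norm_natCast]
  gcongr
  exact he j (by omega)

/-- Norm of `P(w)` from termwise bounds. [cite: FitznerVanDerHofstad2016NoBLE, §5.1.1 (5.4)–(5.5) pp. 1089–1090] -/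
theorem norm_twP_le (m J Jb : ℕ) (Q : ℕ → ℤ) (qden : ℕ) (w : ℝ) (b : ℕ → ℝ)
    (hb : ∀ j, j ≤ J → |(toPolyQ (midList (j * m) Jb)).eval w| ≤ b j) :
    ‖twP m J Jb Q qden w‖ ≤ ∑ j ∈ range (J + 1), (epsN j : ℝ) * (|(Q j : ℝ)| / qden) * b j := by
  rw [twP]
  refine (norm_sum_le _ _).trans (sum_le_sum fun j hj => ?_)
  rw [Finset.mem_range] at hj
  rw [norm_mul, norm_mul, norm_mul, Complex.norm_natCast, norm_pow, Complex.norm_I, one_pow, mul_one,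
    Complex.norm_real, Real.norm_eq_abs, norm_div, Complex.norm_intCast, Complex.norm_natCast]
  gcongr
  exact hb j (by omega)

/-- Monotonicity of the binomial increment: `(x+ρ)^d − x^d ≤ (α+ρ)^d − α^d` for `0 ≤ x ≤ α`, `0 ≤ ρ`.
[cite: FitznerVanDerHofstad2016NoBLE, §5.1.1 (5.4)–(5.5) pp. 1089–1090] -/
theorem add_pow_sub_pow_monoT {x α ρ : ℝ} (hx : 0 ≤ x) (hxa : x ≤ α) (hρ : 0 ≤ ρ) :
    ∀ d : ℕ, (x + ρ) ^ d - x ^ d ≤ (α + ρ) ^ d - α ^ d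
  | 0 => by simp
  | d + 1 => by
    have ih := add_pow_sub_pow_monoT hx hxa hρ d
    have e1 : (x + ρ) ^ (d + 1) - x ^ (d + 1) = (x + ρ) * ((x + ρ) ^ d - x ^ d) + ρ * x ^ d := by ring
    have e2 : (α + ρ) ^ (d + 1) - α ^ (d + 1) = (α + ρ) * ((α + ρ) ^ d - α ^ d) + ρ * α ^ d := by ring
    rw [e1, e2]
    have h0 : 0 ≤ (x + ρ) ^ d - x ^ d := sub_nonneg.mpr (pow_le_pow_left₀ hx (by linarith) d)
    have h1 : (x + ρ) * ((x + ρ) ^ d - x ^ d) ≤ (α + ρ) * ((α + ρ) ^ d - α ^ d) :=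
      mul_le_mul (by linarith) ih h0 (by linarith)
    have h2 : ρ * x ^ d ≤ ρ * α ^ d := mul_le_mul_of_nonneg_left (pow_le_pow_left₀ hx hxa d) hρ
    linarith

end TailSem

/-! ### Part 6c-ii — the `[T,∞)` block in ball form -/

section TailBlock

open Polynomial
open Literature.Probability.LatticeModels (bracketCoeffQ complSum complSum_nonneg invSqrtCoeff_eq_cast
  srwHeatKernel_bracket_eps_coeffQ)

namespace TwCert

variable (c : TwCert) (D : ℕ)

/-- `wabs j = ε_j |Q_j|` as a real. [cite: FitznerVanDerHofstad2016NoBLE, §5.1.1 (5.4)–(5.5) pp. 1089–1090] -/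
theorem cast_wabs (j : ℕ) : ((c.wabs j : ℕ) : ℝ) = (epsN j : ℝ) * |(c.Q j : ℝ)| := by
  rw [TwCert.wabs, epsN, Nat.cast_mul, Nat.cast_natAbs, Int.cast_abs]

/-- `wabsSum = Σ_j ε_j |Q_j|` as a real. [cite: FitznerVanDerHofstad2016NoBLE, §5.1.1 (5.4)–(5.5) pp. 1089–1090] -/
theorem cast_wabsSum : (c.wabsSum : ℝ) = ∑ j ∈ range (c.J + 1), (epsN j : ℝ) * |(c.Q j : ℝ)| := by
  have key : ∀ n : ℕ, ((((List.range n).map c.wabs).sum : ℕ) : ℝ)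
      = ∑ j ∈ range n, (epsN j : ℝ) * |(c.Q j : ℝ)| := by
    intro n
    induction n with
    | zero => simp
    | succ n ih =>
      rw [List.range_succ, List.map_append, List.sum_append, Nat.cast_add, ih, sum_range_succ]
      simp only [List.map_cons, List.map_nil, List.sum_cons, List.sum_nil, add_zero, c.cast_wabs]
  unfold TwCert.wabsSum
  exact key _

/-- `wepsSum = Σ_j ε_j |Q_j| eps(jm)` as a real. [cite: FitznerVanDerHofstad2016NoBLE, §5.1.1 (5.4)–(5.5) pp. 1089–1090] -/
theorem cast_wepsSum : ((c.wepsSum : ℚ) : ℝ)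
    = ∑ j ∈ range (c.J + 1), (epsN j : ℝ) * |(c.Q j : ℝ)| * ((c.eps (j * c.m) : ℚ) : ℝ) := by
  have key : ∀ n : ℕ, ((((List.range n).map fun j => (c.wabs j : ℚ) * c.eps (j * c.m)).sum : ℚ) : ℝ)
      = ∑ j ∈ range n, (epsN j : ℝ) * |(c.Q j : ℝ)| * ((c.eps (j * c.m) : ℚ) : ℝ) := by
    intro n
    induction n with
    | zero => simp
    | succ n ih =>
      rw [List.range_succ, List.map_append, List.sum_append, Rat.cast_add, ih, sum_range_succ]
      simp only [List.map_cons, List.map_nil, List.sum_cons, List.sum_nil, add_zero, Rat.cast_mul,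
        Rat.cast_natCast, c.cast_wabs]
  unfold TwCert.wepsSum
  exact key _

/-- `jm ∈ orders` for `j ≤ J`. [cite: FitznerVanDerHofstad2016NoBLE, §5.1.1 (5.4)–(5.5) pp. 1089–1090] -/
theorem mem_orders {j : ℕ} (hj : j ≤ c.J) : j * c.m ∈ c.orders := by
  rw [TwCert.orders, List.mem_map]
  exact ⟨j, List.mem_range.mpr (by omega), rfl⟩

/-- `0 ∈ orders`. [cite: FitznerVanDerHofstad2016NoBLE, §5.1.1 (5.4)–(5.5) pp. 1089–1090] -/
theorem zero_mem_orders : 0 ∈ c.orders := by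
  have := c.mem_orders (Nat.zero_le c.J)
  rwa [zero_mul] at this

/-- The bracket constant of `srwHeatKernel_bracket_eps_coeffQ` (order `Jb`, `T₀ = t²`) is at most `eps a`
for `a ∈ orders`. [cite: FitznerVanDerHofstad2016NoBLE, §5.1.1 (5.4)–(5.5) pp. 1089–1090] -/
theorem bracketConst_leT (hp : c.ParamsT D) {a : ℕ} (ha : a ∈ c.orders) :
    invSqrtCoeff (c.Jb + 1) / (1 - ((c.s0 : ℚ) : ℝ) ^ 2) * ((2 * c.Jb + 1)‼ : ℝ) / 4 ^ (c.Jb + 1)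
      + √(2 * π) * Real.exp (-(2 * ((c.t : ℝ) ^ 2) * ((c.s0 : ℚ) : ℝ) ^ 2))
        * ((c.t : ℝ) ^ 2) ^ ((c.Jb : ℝ) + 3 / 2)
        * (1 + 2 / π * ∑ i ∈ range (a + c.Jb + 1), |((bracketCoeffQ a c.Jb i : ℚ) : ℝ)|
            * (1 / (2 * ((c.s0 : ℚ) : ℝ)) * complSum i (((c.s0 : ℚ) : ℝ) ^ 2) (2 * (c.t : ℝ) ^ 2)))
      ≤ ((c.eps a : ℚ) : ℝ) := by
  have heps := hp.eps_ge a ha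
  have heps' : ((epsBoundQ a c.Jb c.s0 c.t c.sHi c.nexp : ℚ) : ℝ) ≤ ((c.eps a : ℚ) : ℝ) := by
    exact_mod_cast heps
  refine le_trans ?_ heps'
  rw [epsBoundQ]
  push_cast
  simp only [cast_complSumQ, cast_expPartialQ, ← invSqrtCoeff_eq_cast]
  push_cast
  have ht : (0 : ℝ) < (c.t : ℝ) := by exact_mod_cast hp.t_pos
  have hs0 : (0 : ℝ) < ((c.s0 : ℚ) : ℝ) := by exact_mod_cast hp.s0_pos
  rw [sq_rpow_J (c.t : ℝ) ht c.Jb]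
  refine add_le_add le_rfl ?_
  have hSum0 : 0 ≤ ∑ i ∈ range (a + c.Jb + 1), |((bracketCoeffQ a c.Jb i : ℚ) : ℝ)|
      * (1 / (2 * ((c.s0 : ℚ) : ℝ)) * complSum i (((c.s0 : ℚ) : ℝ) ^ 2) (2 * (c.t : ℝ) ^ 2)) := by
    apply sum_nonneg
    intro i _
    apply mul_nonneg (abs_nonneg _)
    apply mul_nonneg (by positivity)
    exact complSum_nonneg i (by positivity) (by positivity)
  have hsHi : √(2 * π) ≤ ((c.sHi : ℚ) : ℝ) := by
    have h1 : 2 * π ≤ ((c.sHi : ℚ) : ℝ) ^ 2 := by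
      have := hp.sHi_sq
      have h2 : ((2 * piHi : ℚ) : ℝ) ≤ ((c.sHi ^ 2 : ℚ) : ℝ) := by exact_mod_cast this
      push_cast at h2
      linarith [(show Real.pi < ((piHi : ℚ) : ℝ) from Literature.NumberTheory.LFunctions.lt_piHi20)]
    have hpos : (0 : ℝ) ≤ ((c.sHi : ℚ) : ℝ) := by exact_mod_cast hp.sHi_pos.le
    calc √(2 * π) ≤ √(((c.sHi : ℚ) : ℝ) ^ 2) := Real.sqrt_le_sqrt h1
      _ = ((c.sHi : ℚ) : ℝ) := Real.sqrt_sq hpos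
  have hy : (0 : ℝ) ≤ 2 * (c.t : ℝ) ^ 2 * ((c.s0 : ℚ) : ℝ) ^ 2 := by positivity
  have hE0 : 0 < expPartial (2 * (c.t : ℝ) ^ 2 * ((c.s0 : ℚ) : ℝ) ^ 2) c.nexp := by
    obtain ⟨k, hk⟩ : ∃ k, c.nexp = k + 1 := ⟨c.nexp - 1, by have := hp.nexp_pos; omega⟩
    rw [hk, expPartial, Finset.sum_range_succ']
    simp only [pow_zero, Nat.factorial_zero, Nat.cast_one, div_one]
    have : 0 ≤ ∑ i ∈ range k, (2 * (c.t : ℝ) ^ 2 * ((c.s0 : ℚ) : ℝ) ^ 2) ^ (i + 1) / ((i + 1)! : ℝ) :=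
      sum_nonneg fun i _ => by positivity
    linarith
  have hexp : Real.exp (-(2 * (c.t : ℝ) ^ 2 * ((c.s0 : ℚ) : ℝ) ^ 2))
      ≤ 1 / expPartial (2 * (c.t : ℝ) ^ 2 * ((c.s0 : ℚ) : ℝ) ^ 2) c.nexp := by
    rw [Real.exp_neg, ← one_div]
    exact one_div_le_one_div_of_le hE0 (expPartial_le_exp hy _)
  have hpi : 2 / π ≤ 2 / ((piLo : ℚ) : ℝ) :=
    div_le_div_of_nonneg_left (by norm_num) piLo_pos
      (show ((piLo : ℚ) : ℝ) < Real.pi from Literature.NumberTheory.LFunctions.piLo20_lt).le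
  have hA : √(2 * π) * Real.exp (-(2 * (c.t : ℝ) ^ 2 * ((c.s0 : ℚ) : ℝ) ^ 2))
      ≤ ((c.sHi : ℚ) : ℝ) * (1 / expPartial (2 * (c.t : ℝ) ^ 2 * ((c.s0 : ℚ) : ℝ) ^ 2) c.nexp) :=
    mul_le_mul hsHi hexp (Real.exp_nonneg _) (by exact_mod_cast hp.sHi_pos.le)
  have hB : 1 + 2 / π * ∑ i ∈ range (a + c.Jb + 1), |((bracketCoeffQ a c.Jb i : ℚ) : ℝ)|
        * (1 / (2 * ((c.s0 : ℚ) : ℝ)) * complSum i (((c.s0 : ℚ) : ℝ) ^ 2) (2 * (c.t : ℝ) ^ 2))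
      ≤ 1 + 2 / ((piLo : ℚ) : ℝ) * ∑ i ∈ range (a + c.Jb + 1), |((bracketCoeffQ a c.Jb i : ℚ) : ℝ)|
        * (1 / (2 * ((c.s0 : ℚ) : ℝ)) * complSum i (((c.s0 : ℚ) : ℝ) ^ 2) (2 * (c.t : ℝ) ^ 2)) :=
    add_le_add le_rfl (mul_le_mul_of_nonneg_right hpi hSum0)
  have hP0 : (0 : ℝ) ≤ ((c.t : ℝ) ^ 2) ^ (c.Jb + 1) * (c.t : ℝ) := by positivity
  have hB0 : (0 : ℝ) ≤ 1 + 2 / π * ∑ i ∈ range (a + c.Jb + 1), |((bracketCoeffQ a c.Jb i : ℚ) : ℝ)|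
        * (1 / (2 * ((c.s0 : ℚ) : ℝ)) * complSum i (((c.s0 : ℚ) : ℝ) ^ 2) (2 * (c.t : ℝ) ^ 2)) := by
    positivity
  calc √(2 * π) * Real.exp (-(2 * (c.t : ℝ) ^ 2 * ((c.s0 : ℚ) : ℝ) ^ 2))
        * (((c.t : ℝ) ^ 2) ^ (c.Jb + 1) * (c.t : ℝ)) * _
      ≤ ((c.sHi : ℚ) : ℝ) * (1 / expPartial (2 * (c.t : ℝ) ^ 2 * ((c.s0 : ℚ) : ℝ) ^ 2) c.nexp)
        * (((c.t : ℝ) ^ 2) ^ (c.Jb + 1) * (c.t : ℝ)) * _ := by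
        apply mul_le_mul (mul_le_mul_of_nonneg_right hA hP0) hB hB0
        exact mul_nonneg (mul_nonneg (by exact_mod_cast hp.sHi_pos.le) (by positivity)) hP0
    _ = _ := by ring

/-- **The midpoint bracket** for `a ∈ orders`, `u ≥ t²`:
`|√(2πu) q_u(a) − Mid_a(1/u)| ≤ eps_a (1/u)^{Jb+1}`. [cite: FitznerVanDerHofstad2016NoBLE, §5.1.1 (5.4)–(5.5) pp. 1089–1090] -/
theorem mid_bracketT (hp : c.ParamsT D) {a : ℕ} (ha : a ∈ c.orders) {u : ℝ} (hu : (c.t : ℝ) ^ 2 ≤ u) :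
    |√(2 * π * u) * srwHeatKernel u (a : ℤ) - (toPolyQ (midList a c.Jb)).eval (1 / u)|
      ≤ ((c.eps a : ℚ) : ℝ) * (1 / u) ^ (c.Jb + 1) := by
  have ht : (0 : ℝ) < (c.t : ℝ) := by exact_mod_cast hp.t_pos
  have hu0 : 0 < u := lt_of_lt_of_le (by positivity) hu
  have hs0 : (0 : ℝ) < ((c.s0 : ℚ) : ℝ) := by exact_mod_cast hp.s0_pos
  have hs1 : ((c.s0 : ℚ) : ℝ) < 1 := by exact_mod_cast hp.s0_lt
  have hTc : ((c.Jb : ℝ) + 3 / 2) / (2 * ((c.s0 : ℚ) : ℝ) ^ 2) ≤ (c.t : ℝ) ^ 2 := by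
    have h' := (Rat.cast_le (K := ℝ)).mpr hp.hT
    push_cast at h'
    exact h'
  have hb := srwHeatKernel_bracket_eps_coeffQ (u := u) hs0 hs1 (a : ℤ) c.Jb hTc hu
  simp only [Int.natAbs_natCast] at hb
  have hC := c.bracketConst_leT D hp ha
  have hmain : ∑ i ∈ range (a + c.Jb + 1),
        ((bracketCoeffQ a c.Jb i : ℚ) : ℝ) * ((2 * i - 1)‼ : ℝ) / (4 * u) ^ i
      = ∑ i ∈ range (a + c.Jb + 1), ((mcoef a c.Jb i : ℚ) : ℝ) * (1 / u) ^ i := by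
    refine sum_congr rfl fun i _ => ?_
    rw [mcoef]; push_cast
    rw [mul_pow, one_div_pow]
    field_simp
  rw [hmain] at hb
  have hw : (u ^ (c.Jb + 1))⁻¹ = (1 / u) ^ (c.Jb + 1) := by rw [one_div_pow, one_div]
  rw [hw] at hb
  have hw0 : (0 : ℝ) ≤ (1 / u) ^ (c.Jb + 1) := by positivity
  rw [eval_toPolyQ_midList]
  exact hb.trans (mul_le_mul_of_nonneg_right hC hw0)

/-- The upper bracket at order `0`: `√(2πu) q_u(0) ≤ U_0(1/u)` (`u ≥ t²`).
[cite: FitznerVanDerHofstad2016NoBLE, §5.1.1 (5.4)–(5.5) pp. 1089–1090] -/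
theorem upper0T (hp : c.ParamsT D) {u : ℝ} (hu : (c.t : ℝ) ^ 2 ≤ u) :
    √(2 * π * u) * srwHeatKernel u 0 ≤ (toPolyQ (upList 0 c.Jb (c.eps 0))).eval (1 / u) := by
  have h := c.mid_bracketT D hp c.zero_mem_orders hu
  rw [Int.natCast_zero] at h
  rw [eval_toPolyQ_upList, ← eval_toPolyQ_midList]
  have := (abs_sub_le_iff.1 h).1
  linarith

/-- **The `E`-bound**: `‖F(u) − P(1/u)‖ ≤ ρ (1/u)^{Jb+1}` for `u ≥ t²`. [cite: FitznerVanDerHofstad2016NoBLE, §5.1.1 (5.4)–(5.5) pp. 1089–1090] -/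
theorem E_boundT (hp : c.ParamsT D) {u : ℝ} (hu : (c.t : ℝ) ^ 2 ≤ u) :
    ‖twF c.m c.J c.Q c.qden u - twP c.m c.J c.Jb c.Q c.qden (1 / u)‖
      ≤ ((c.rho : ℚ) : ℝ) * (1 / u) ^ (c.Jb + 1) := by
  have ht : (0 : ℝ) < (c.t : ℝ) := by exact_mod_cast hp.t_pos
  have hu0 : 0 < u := lt_of_lt_of_le (by positivity) hu
  have hq0 : (0 : ℝ) < c.qden := by exact_mod_cast hp.qden_pos
  have hw0 : (0 : ℝ) ≤ (1 / u) ^ (c.Jb + 1) := by positivity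
  have h1 := norm_twF_sub_twP_le c.m c.J c.Jb c.Q c.qden u (1 / u)
    (fun j => ((c.eps (j * c.m) : ℚ) : ℝ) * (1 / u) ^ (c.Jb + 1))
    (fun j hj => c.mid_bracketT D hp (c.mem_orders hj) hu)
  have h2 : ∑ j ∈ range (c.J + 1), (epsN j : ℝ) * (|(c.Q j : ℝ)| / c.qden)
        * (((c.eps (j * c.m) : ℚ) : ℝ) * (1 / u) ^ (c.Jb + 1))
      = ((c.wepsSum : ℚ) : ℝ) / c.qden * (1 / u) ^ (c.Jb + 1) := by
    rw [c.cast_wepsSum, sum_div, sum_mul]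
    refine sum_congr rfl fun j _ => ?_
    field_simp
  rw [h2] at h1
  refine h1.trans (mul_le_mul_of_nonneg_right ?_ hw0)
  rw [div_le_iff₀ hq0]
  exact_mod_cast hp.weps_le

/-- `U_0(w)` abbreviation: the upper bracket polynomial of order `0`, evaluated. [cite: FitznerVanDerHofstad2016NoBLE, §5.1.1 (5.4)–(5.5) pp. 1089–1090] -/
noncomputable def U0 (w : ℝ) : ℝ := (toPolyQ (upList 0 c.Jb (c.eps 0))).eval w

/-- **The `P`-bound**: `‖P(1/u)‖ ≤ α U_0(1/u) + ρ (1/u)^{Jb+1}` for `u ≥ t²`, and `0 ≤ U_0(1/u)`.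
[cite: FitznerVanDerHofstad2016NoBLE, §5.1.1 (5.4)–(5.5) pp. 1089–1090] -/
theorem P_boundT (hp : c.ParamsT D) {u : ℝ} (hu : (c.t : ℝ) ^ 2 ≤ u) :
    ‖twP c.m c.J c.Jb c.Q c.qden (1 / u)‖
        ≤ ((c.alpha : ℚ) : ℝ) * c.U0 (1 / u) + ((c.rho : ℚ) : ℝ) * (1 / u) ^ (c.Jb + 1) ∧
      0 ≤ c.U0 (1 / u) := by
  have ht : (0 : ℝ) < (c.t : ℝ) := by exact_mod_cast hp.t_pos
  have hu0 : 0 < u := lt_of_lt_of_le (by positivity) hu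
  have hq0 : (0 : ℝ) < c.qden := by exact_mod_cast hp.qden_pos
  have hw0 : (0 : ℝ) ≤ (1 / u) ^ (c.Jb + 1) := by positivity
  have hU := c.upper0T D hp hu
  have hk0 : 0 ≤ √(2 * π * u) * srwHeatKernel u 0 :=
    mul_nonneg (Real.sqrt_nonneg _) (srwHeatKernel_nonneg hu0.le _)
  have hU0 : 0 ≤ c.U0 (1 / u) := hk0.trans hU
  refine ⟨?_, hU0⟩
  have hb : ∀ j, j ≤ c.J → |(toPolyQ (midList (j * c.m) c.Jb)).eval (1 / u)|
      ≤ c.U0 (1 / u) + ((c.eps (j * c.m) : ℚ) : ℝ) * (1 / u) ^ (c.Jb + 1) := by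
    intro j hj
    have hm := c.mid_bracketT D hp (c.mem_orders hj) hu
    have hkj0 : 0 ≤ √(2 * π * u) * srwHeatKernel u ((j * c.m : ℕ) : ℤ) :=
      mul_nonneg (Real.sqrt_nonneg _) (srwHeatKernel_nonneg hu0.le _)
    have hkj : √(2 * π * u) * srwHeatKernel u ((j * c.m : ℕ) : ℤ) ≤ √(2 * π * u) * srwHeatKernel u 0 :=
      mul_le_mul_of_nonneg_left (srwHeatKernel_le_zero_index hu0.le _) (Real.sqrt_nonneg _)
    rw [abs_le]
    obtain ⟨hm1, hm2⟩ := abs_sub_le_iff.1 hm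
    have hU' : √(2 * π * u) * srwHeatKernel u 0 ≤ c.U0 (1 / u) := hU
    constructor <;> nlinarith
  have h1 := norm_twP_le c.m c.J c.Jb c.Q c.qden (1 / u) _ hb
  have h2 : ∑ j ∈ range (c.J + 1), (epsN j : ℝ) * (|(c.Q j : ℝ)| / c.qden)
        * (c.U0 (1 / u) + ((c.eps (j * c.m) : ℚ) : ℝ) * (1 / u) ^ (c.Jb + 1))
      = (c.wabsSum : ℝ) / c.qden * c.U0 (1 / u)
        + ((c.wepsSum : ℚ) : ℝ) / c.qden * (1 / u) ^ (c.Jb + 1) := by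
    rw [c.cast_wepsSum, c.cast_wabsSum, sum_div, sum_div, sum_mul, sum_mul, ← sum_add_distrib]
    refine sum_congr rfl fun j _ => ?_
    field_simp
  rw [h2] at h1
  refine h1.trans (add_le_add (mul_le_mul_of_nonneg_right ?_ hU0) (mul_le_mul_of_nonneg_right ?_ hw0))
  · rw [div_le_iff₀ hq0]
    exact_mod_cast hp.wabs_le
  · rw [div_le_iff₀ hq0]
    exact_mod_cast hp.weps_le

/-- **The perturbation step**: with `G₁ = α U_0 + ρ w^{Jb+1}`, `G₂ = α U_0 + 2ρ w^{Jb+1}` (`w = 1/u`, `u ≥ t²`),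
`|Re F(u)^D − Re P(1/u)^D| ≤ G₂^D − G₁^D`. [cite: FitznerVanDerHofstad2016NoBLE, §5.1.1 (5.4)–(5.5) pp. 1089–1090] -/
theorem re_pow_perturbT (hp : c.ParamsT D) {u : ℝ} (hu : (c.t : ℝ) ^ 2 ≤ u) :
    |(twF c.m c.J c.Q c.qden u ^ D).re - (twP c.m c.J c.Jb c.Q c.qden (1 / u) ^ D).re|
      ≤ (((c.alpha : ℚ) : ℝ) * c.U0 (1 / u) + 2 * (((c.rho : ℚ) : ℝ) * (1 / u) ^ (c.Jb + 1))) ^ D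
        - (((c.alpha : ℚ) : ℝ) * c.U0 (1 / u) + ((c.rho : ℚ) : ℝ) * (1 / u) ^ (c.Jb + 1)) ^ D := by
  have ht : (0 : ℝ) < (c.t : ℝ) := by exact_mod_cast hp.t_pos
  have hu0 : 0 < u := lt_of_lt_of_le (by positivity) hu
  have hρ0 : 0 ≤ ((c.rho : ℚ) : ℝ) * (1 / u) ^ (c.Jb + 1) :=
    mul_nonneg (by exact_mod_cast hp.rho_nonneg) (by positivity)
  set P := twP c.m c.J c.Jb c.Q c.qden (1 / u) with hP
  set F := twF c.m c.J c.Q c.qden u with hF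
  have hE := c.E_boundT D hp hu
  rw [← hF, ← hP] at hE
  have h1 := abs_re_add_pow_sub_re_pow_le_of_norm_le P (F - P) hE D
  rw [add_sub_cancel] at h1
  obtain ⟨hPle, _⟩ := c.P_boundT D hp hu
  rw [← hP] at hPle
  have h2 := add_pow_sub_pow_monoT (norm_nonneg P) hPle hρ0 D
  rw [show ((c.alpha : ℚ) : ℝ) * c.U0 (1 / u) + 2 * (((c.rho : ℚ) : ℝ) * (1 / u) ^ (c.Jb + 1))
      = ((c.alpha : ℚ) : ℝ) * c.U0 (1 / u) + ((c.rho : ℚ) : ℝ) * (1 / u) ^ (c.Jb + 1)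
        + ((c.rho : ℚ) : ℝ) * (1 / u) ^ (c.Jb + 1) by ring]
  exact h1.trans h2

/-! #### Real meanings of `IM`, `IB` and the assembly of the `[T,∞)` block -/

/-- Every order's bracket list fits in `lw`. [cite: FitznerVanDerHofstad2016NoBLE, §5.1.1 (5.4)–(5.5) pp. 1089–1090] -/
theorem blen_le_lw {j : ℕ} (hj : j ≤ c.J) : blen (j * c.m) c.Jb ≤ c.lw := by
  have := Nat.mul_le_mul_right c.m hj
  unfold TwCert.lw blen
  omega

/-- `Re P(w)^D = pnPoly(powRe)(w)/(2^S qden)^D`. [cite: FitznerVanDerHofstad2016NoBLE, §5.1.1 (5.4)–(5.5) pp. 1089–1090] -/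
theorem re_twP_pow_eq (hp : c.ParamsT D) (w : ℝ) :
    ((twP c.m c.J c.Jb c.Q c.qden w) ^ D).re
      = (pnPoly (c.powRe D)).eval w / (((2 : ℝ) ^ c.S * c.qden) ^ D) := by
  have hD1 : 1 ≤ D := by have := hp.hD; omega
  have hq0 : (0 : ℝ) < c.qden := by exact_mod_cast hp.qden_pos
  rw [c.powRe_eval D hD1 hp.qden_pos (fun j hj => hp.mid_dy _ (c.mem_orders hj))
    (fun j hj => c.blen_le_lw hj) w, mul_div_cancel_left₀]
  positivity

/-- `0 ≤ α` (from `wabsSum ≤ α qden`). [cite: FitznerVanDerHofstad2016NoBLE, §5.1.1 (5.4)–(5.5) pp. 1089–1090] -/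
theorem alpha_nonneg (hp : c.ParamsT D) : 0 ≤ c.alpha := by
  have hq0 : (0 : ℚ) < c.qden := by exact_mod_cast hp.qden_pos
  have h := hp.wabs_le
  have h0 : (0 : ℚ) ≤ c.wabsSum := by exact_mod_cast Nat.zero_le _
  by_contra hlt
  rw [not_le] at hlt
  have := mul_neg_of_neg_of_pos hlt hq0
  linarith

/-- The majorant base lists evaluate to `2^{2S}(α U_0(w) + k ρ w^{Jb+1})`. [cite: FitznerVanDerHofstad2016NoBLE, §5.1.1 (5.4)–(5.5) pp. 1089–1090] -/
theorem G_eval (hp : c.ParamsT D) (k : ℕ) (w : ℝ) :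
    (toPolyN (majBase c.Jb c.S c.lg (c.eps 0) c.alpha c.rho k)).eval w
      = (2 : ℝ) ^ (2 * c.S) * (((c.alpha : ℚ) : ℝ) * c.U0 w
          + (k : ℝ) * ((c.rho : ℚ) : ℝ) * w ^ (c.Jb + 1)) :=
  eval_toPolyN_majBase c.Jb c.S (c.eps 0) c.alpha c.rho k hp.alpha_dy hp.rho_dy hp.up_dy
    (c.alpha_nonneg D hp) hp.rho_nonneg hp.up_nonneg w

/-- Their `D`-th powers. [cite: FitznerVanDerHofstad2016NoBLE, §5.1.1 (5.4)–(5.5) pp. 1089–1090] -/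
theorem G_pow_eval (hp : c.ParamsT D) (k : ℕ) (w : ℝ) :
    (toPolyN (powN c.lg (majBase c.Jb c.S c.lg (c.eps 0) c.alpha c.rho k) D)).eval w
      = ((2 : ℝ) ^ (2 * c.S)) ^ D * (((c.alpha : ℚ) : ℝ) * c.U0 w
          + (k : ℝ) * ((c.rho : ℚ) : ℝ) * w ^ (c.Jb + 1)) ^ D := by
  have hlg : 1 ≤ c.lg := by unfold TwCert.lg blen; omega
  obtain ⟨h, -⟩ := toPolyN_powN c.lg hlg (majBase c.Jb c.S c.lg (c.eps 0) c.alpha c.rho k)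
    (by rw [length_majBase]) D
  rw [h, eval_pow, c.G_eval D hp k w, mul_pow]

/-- `pnPoly (g₂^D, g₁^D)(w) = 2^{2SD}(G₂(w)^D − G₁(w)^D)`. [cite: FitznerVanDerHofstad2016NoBLE, §5.1.1 (5.4)–(5.5) pp. 1089–1090] -/
theorem gg_eval (hp : c.ParamsT D) (w : ℝ) :
    (pnPoly (powN c.lg c.g2 D, powN c.lg c.g1 D)).eval w
      = ((2 : ℝ) ^ (2 * c.S)) ^ D
        * ((((c.alpha : ℚ) : ℝ) * c.U0 w + 2 * (((c.rho : ℚ) : ℝ) * w ^ (c.Jb + 1))) ^ D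
          - (((c.alpha : ℚ) : ℝ) * c.U0 w + ((c.rho : ℚ) : ℝ) * w ^ (c.Jb + 1)) ^ D) := by
  rw [pnPoly, eval_sub]
  change (toPolyN (powN c.lg (majBase c.Jb c.S c.lg (c.eps 0) c.alpha c.rho 2) D)).eval w
    - (toPolyN (powN c.lg (majBase c.Jb c.S c.lg (c.eps 0) c.alpha c.rho 1) D)).eval w = _
  rw [c.G_pow_eval D hp 2 w, c.G_pow_eval D hp 1 w, ← mul_sub]
  push_cast
  ring

/-- **The `[T,∞)` block in ball form**: `tailLo_n ≤ ∫_{t²}^∞ u^{n'} Re Ψ(u)^D du ≤ tailHi_n` (`n = n'+1 ≤ 4`),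
from the parameter facts and `tailCheckT`. [cite: FitznerVanDerHofstad2016NoBLE, §5.1.1 (5.4)–(5.5) pp. 1089–1090] -/
theorem ioi_blockT (hp : c.ParamsT D) (htc : c.tailCheckT D = true) (n' : ℕ) (hn : n' ≤ 3) :
    c.IoiBlockT D n' := by
  rw [TwCert.IoiBlockT]
  have ht : (0 : ℝ) < (c.t : ℝ) := by exact_mod_cast hp.t_pos
  have hT0 : (0 : ℝ) < (c.t : ℝ) ^ 2 := by positivity
  have hd : 2 * n' + 3 ≤ D := by have := hp.hD; omega
  have hD2 : 2 ≤ D := by have := hp.hD; omega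
  have hq0 : (0 : ℝ) < c.qden := by exact_mod_cast hp.qden_pos
  obtain ⟨him1, him2, hib⟩ := c.tailCheckT_spec D htc (n' + 1) (by omega) (by omega)
  set κ : ℝ := ((√(2 * π)) ^ D)⁻¹ with hκ
  have hκ0 : 0 < κ := by positivity
  set g : ℝ → ℝ := fun u => u ^ n' * (twPsi c.m c.J c.Q c.qden u ^ D).re with hg
  set gg : List ℕ × List ℕ := (powN c.lg c.g2 D, powN c.lg c.g1 D) with hgg
  set fM : ℝ → ℝ := fun u => κ * (u ^ n' / (√u) ^ D * (pnPoly (c.powRe D)).eval (1 / u))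
    / (((2 : ℝ) ^ c.S * c.qden) ^ D) with hfM
  set fB : ℝ → ℝ := fun u => κ * (u ^ n' / (√u) ^ D * (pnPoly gg).eval (1 / u))
    / (((2 : ℝ) ^ (2 * c.S)) ^ D) with hfB
  have hlenP : (c.powRe D).1.length = (c.powRe D).2.length := by
    obtain ⟨h1, h2, -, -⟩ := gzPowW_len c.lw c.gzPw D hD2
    change (gzPowW c.lw c.gzPw D).1.1.length = (gzPowW c.lw c.gzPw D).1.2.length
    rw [h1, h2]
  have hlenG : gg.1.length = gg.2.length := by
    simp only [hgg]; rw [length_powN, length_powN]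
  obtain ⟨hintM, hIMeq⟩ := integral_tailPoly hp.t_pos hd (c.powRe D) hlenP
  obtain ⟨hintG, hIGeq⟩ := integral_tailPoly hp.t_pos hd gg hlenG
  have hfM_int : IntegrableOn fM (Ioi ((c.t : ℝ) ^ 2)) := by
    rw [hfM]; exact (hintM.const_mul κ).div_const _
  have hfB_int : IntegrableOn fB (Ioi ((c.t : ℝ) ^ 2)) := by
    rw [hfB]; exact (hintG.const_mul κ).div_const _
  set IMr : ℝ := ((c.IM D (c.powRe D) (n' + 1) : ℚ) : ℝ) with hIMr
  set IBr : ℝ := ((c.IB D gg (n' + 1) : ℚ) : ℝ) with hIBr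
  have hIM : ∫ u in Ioi ((c.t : ℝ) ^ 2), fM u = κ * IMr := by
    rw [hfM, integral_div, integral_const_mul, hIMeq, hIMr, TwCert.IM, TwCert.scaleP]
    push_cast
    ring
  have hIB : ∫ u in Ioi ((c.t : ℝ) ^ 2), fB u = κ * IBr := by
    rw [hfB, integral_div, integral_const_mul, hIGeq, hIBr, TwCert.IB, TwCert.scaleG]
    push_cast
    ring
  -- pointwise comparison on `(t², ∞)`
  have hle : ∀ u ∈ Ioi ((c.t : ℝ) ^ 2), fM u - fB u ≤ g u ∧ g u ≤ fM u + fB u ∧ 0 ≤ fB u := by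
    intro u hu
    rw [Set.mem_Ioi] at hu
    have hu0 : 0 < u := hT0.trans hu
    have hfac : 0 ≤ κ * (u ^ n' / (√u) ^ D) := by positivity
    have hpert := c.re_pow_perturbT D hp hu.le
    have hgu : g u = κ * (u ^ n' / (√u) ^ D) * (twF c.m c.J c.Q c.qden u ^ D).re := by
      simp only [hg]
      exact integrand_eqT c.m c.J c.Q c.qden D n' hu0
    have hfMu : fM u = κ * (u ^ n' / (√u) ^ D) * (twP c.m c.J c.Jb c.Q c.qden (1 / u) ^ D).re := by
      simp only [hfM]
      rw [c.re_twP_pow_eq D hp (1 / u)]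
      ring
    have hfBu : fB u = κ * (u ^ n' / (√u) ^ D)
        * ((((c.alpha : ℚ) : ℝ) * c.U0 (1 / u) + 2 * (((c.rho : ℚ) : ℝ) * (1 / u) ^ (c.Jb + 1))) ^ D
          - (((c.alpha : ℚ) : ℝ) * c.U0 (1 / u) + ((c.rho : ℚ) : ℝ) * (1 / u) ^ (c.Jb + 1)) ^ D) := by
      simp only [hfB]
      rw [c.gg_eval D hp (1 / u)]
      have h2 : ((2 : ℝ) ^ (2 * c.S)) ^ D ≠ 0 := by positivity
      field_simp
    rw [hgu, hfMu, hfBu, ← mul_sub, ← mul_add]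
    obtain ⟨h1, h2⟩ := abs_sub_le_iff.1 hpert
    exact ⟨mul_le_mul_of_nonneg_left (by linarith) hfac, mul_le_mul_of_nonneg_left (by linarith) hfac,
      mul_nonneg hfac ((abs_nonneg _).trans hpert)⟩
  have hg_int : IntegrableOn g (Ioi ((c.t : ℝ) ^ 2)) :=
    (integrableOn_ublock c.m c.J c.Q c.qden hp.qden_pos hp.Q_le n' hd).mono_set (Ioi_subset_Ioi hT0.le)
  have hlowI : κ * IMr - κ * IBr ≤ ∫ u in Ioi ((c.t : ℝ) ^ 2), g u := by
    rw [← hIM, ← hIB, ← integral_sub hfM_int hfB_int]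
    exact setIntegral_mono_on (hfM_int.sub hfB_int) hg_int measurableSet_Ioi fun u hu => (hle u hu).1
  have hupI : ∫ u in Ioi ((c.t : ℝ) ^ 2), g u ≤ κ * IMr + κ * IBr := by
    rw [← hIM, ← hIB, ← integral_add hfM_int hfB_int]
    exact setIntegral_mono_on hg_int (hfM_int.add hfB_int) measurableSet_Ioi fun u hu => (hle u hu).2.1
  have hIB0 : 0 ≤ IBr := by
    have h0 : 0 ≤ ∫ u in Ioi ((c.t : ℝ) ^ 2), fB u :=
      setIntegral_nonneg measurableSet_Ioi fun u hu => (hle u hu).2.2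
    rw [hIB] at h0
    by_contra hneg
    rw [not_le] at hneg
    have := mul_neg_of_pos_of_neg hκ0 hneg
    linarith
  -- the `(2π)^{-D/2}` brackets
  have hsHi : √(2 * π) ≤ ((c.sHi : ℚ) : ℝ) := by
    have h1 : 2 * π ≤ ((c.sHi : ℚ) : ℝ) ^ 2 := by
      have h2 : ((2 * piHi : ℚ) : ℝ) ≤ ((c.sHi ^ 2 : ℚ) : ℝ) := by exact_mod_cast hp.sHi_sq
      push_cast at h2
      linarith [(show Real.pi < ((piHi : ℚ) : ℝ) from Literature.NumberTheory.LFunctions.lt_piHi20)]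
    calc √(2 * π) ≤ √(((c.sHi : ℚ) : ℝ) ^ 2) := Real.sqrt_le_sqrt h1
      _ = ((c.sHi : ℚ) : ℝ) := Real.sqrt_sq (by exact_mod_cast hp.sHi_pos.le)
  have hsLo : ((c.sLo : ℚ) : ℝ) ≤ √(2 * π) := by
    have h1 : ((c.sLo : ℚ) : ℝ) ^ 2 ≤ 2 * π := by
      have h2 : ((c.sLo ^ 2 : ℚ) : ℝ) ≤ ((2 * piLo : ℚ) : ℝ) := by exact_mod_cast hp.sLo_sq
      push_cast at h2
      linarith [(show ((piLo : ℚ) : ℝ) < Real.pi from Literature.NumberTheory.LFunctions.piLo20_lt)]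
    calc ((c.sLo : ℚ) : ℝ) = √(((c.sLo : ℚ) : ℝ) ^ 2) :=
          (Real.sqrt_sq (by exact_mod_cast hp.sLo_pos.le)).symm
      _ ≤ √(2 * π) := Real.sqrt_le_sqrt h1
  have hsLo0 : (0 : ℝ) < ((c.sLo : ℚ) : ℝ) := by exact_mod_cast hp.sLo_pos
  have hkLo : ((c.kLoT D : ℚ) : ℝ) ≤ κ := by
    rw [TwCert.kLoT, hκ]; push_cast
    rw [← one_div]
    apply one_div_le_one_div_of_le (by positivity)
    exact pow_le_pow_left₀ (by positivity) hsHi D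
  have hkHi : κ ≤ ((c.kHiT D : ℚ) : ℝ) := by
    rw [TwCert.kHiT, hκ]; push_cast
    rw [← one_div]
    apply one_div_le_one_div_of_le (by positivity)
    exact pow_le_pow_left₀ hsLo0.le hsLo D
  -- the sign-aware final brackets
  have hr : ((c.imLo (n' + 1) : ℚ) : ℝ) - ((c.ibHi (n' + 1) : ℚ) : ℝ) ≤ IMr - IBr := by
    have h1 : ((c.imLo (n' + 1) : ℚ) : ℝ) ≤ IMr := by rw [hIMr]; exact_mod_cast him1
    have h2 : IBr ≤ ((c.ibHi (n' + 1) : ℚ) : ℝ) := by rw [hIBr]; exact_mod_cast hib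
    linarith
  have hs : IMr + IBr ≤ ((c.imHi (n' + 1) : ℚ) : ℝ) + ((c.ibHi (n' + 1) : ℚ) : ℝ) := by
    have h1 : IMr ≤ ((c.imHi (n' + 1) : ℚ) : ℝ) := by rw [hIMr]; exact_mod_cast him2
    have h2 : IBr ≤ ((c.ibHi (n' + 1) : ℚ) : ℝ) := by rw [hIBr]; exact_mod_cast hib
    linarith
  constructor
  · have hk : ((c.tailLo D (n' + 1) : ℚ) : ℝ)
        ≤ κ * (((c.imLo (n' + 1) : ℚ) : ℝ) - ((c.ibHi (n' + 1) : ℚ) : ℝ)) := by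
      simp only [TwCert.tailLo]
      split_ifs with hsgn
      · have hr0 : (0 : ℝ) ≤ ((c.imLo (n' + 1) : ℚ) : ℝ) - ((c.ibHi (n' + 1) : ℚ) : ℝ) := by
          have : ((0 : ℚ) : ℝ) ≤ ((c.imLo (n' + 1) - c.ibHi (n' + 1) : ℚ) : ℝ) := by exact_mod_cast hsgn
          push_cast at this; linarith
        push_cast
        exact mul_le_mul_of_nonneg_right hkLo hr0
      · rw [not_le] at hsgn
        have hr0 : ((c.imLo (n' + 1) : ℚ) : ℝ) - ((c.ibHi (n' + 1) : ℚ) : ℝ) ≤ 0 := by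
          have : ((c.imLo (n' + 1) - c.ibHi (n' + 1) : ℚ) : ℝ) ≤ ((0 : ℚ) : ℝ) := by exact_mod_cast hsgn.le
          push_cast at this; linarith
        push_cast
        exact mul_le_mul_of_nonpos_right hkHi hr0
    calc ((c.tailLo D (n' + 1) : ℚ) : ℝ)
        ≤ κ * (((c.imLo (n' + 1) : ℚ) : ℝ) - ((c.ibHi (n' + 1) : ℚ) : ℝ)) := hk
      _ ≤ κ * (IMr - IBr) := mul_le_mul_of_nonneg_left hr hκ0.le
      _ = κ * IMr - κ * IBr := by ring
      _ ≤ _ := hlowI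
  · have hk : κ * (((c.imHi (n' + 1) : ℚ) : ℝ) + ((c.ibHi (n' + 1) : ℚ) : ℝ))
        ≤ ((c.tailHi D (n' + 1) : ℚ) : ℝ) := by
      simp only [TwCert.tailHi]
      split_ifs with hsgn
      · have hs0 : (0 : ℝ) ≤ ((c.imHi (n' + 1) : ℚ) : ℝ) + ((c.ibHi (n' + 1) : ℚ) : ℝ) := by
          have : ((0 : ℚ) : ℝ) ≤ ((c.imHi (n' + 1) + c.ibHi (n' + 1) : ℚ) : ℝ) := by exact_mod_cast hsgn
          push_cast at this; linarith
        push_cast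
        exact mul_le_mul_of_nonneg_right hkHi hs0
      · rw [not_le] at hsgn
        have hs0 : ((c.imHi (n' + 1) : ℚ) : ℝ) + ((c.ibHi (n' + 1) : ℚ) : ℝ) ≤ 0 := by
          have : ((c.imHi (n' + 1) + c.ibHi (n' + 1) : ℚ) : ℝ) ≤ ((0 : ℚ) : ℝ) := by exact_mod_cast hsgn.le
          push_cast at this; linarith
        push_cast
        exact mul_le_mul_of_nonpos_right hkLo hs0
    calc ∫ u in Ioi ((c.t : ℝ) ^ 2), g u ≤ κ * IMr + κ * IBr := hupI
      _ = κ * (IMr + IBr) := by ring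
      _ ≤ κ * (((c.imHi (n' + 1) : ℚ) : ℝ) + ((c.ibHi (n' + 1) : ℚ) : ℝ)) :=
          mul_le_mul_of_nonneg_left hs hκ0.le
      _ ≤ _ := hk

/-! ### The soundness theorem -/

/-- **Soundness of the twisted SEEDCERT kernel**: if `checkT D` holds (parameter sanity, the `[0,T]`
Poisson-block brackets, the `[T,∞)` ball-form tail brackets and the final assembly), then for `1 ≤ n ≤ 4` the
literal row object of `SrwTwistTruncationSeeds` (the `u`-substituted, Bessel-twisted seed integral at the
weights `c_j = 2π i^j Q_j/qden`) lies in `[lo n, hi n]`.  Generic in the dimension `D ≥ 9`; number-free.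
[cite: FitznerVanDerHofstad2016NoBLE, §5.1.1 (5.2)–(5.5) pp. 1089–1090] -/
theorem soundT (h : c.checkT D = true) (n : ℕ) (hn1 : 1 ≤ n) (hn4 : n ≤ 4) :
    ((c.lo n : ℚ) : ℝ)
        ≤ ((n - 1) ! : ℝ)⁻¹ * (∫ τ in Ioi (0:ℝ), τ ^ (n - 1) * (Real.exp (-τ) *
            ((∑ j ∈ Finset.range (c.J + 1), (if j = 0 then (1 : ℂ) else 2)
              * ((besselI (j * (c.m : ℤ)) (τ / D) : ℂ) * c.cT j)) ^ D).re)) / (2 * π) ^ D ∧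
    ((n - 1) ! : ℝ)⁻¹ * (∫ τ in Ioi (0:ℝ), τ ^ (n - 1) * (Real.exp (-τ) *
            ((∑ j ∈ Finset.range (c.J + 1), (if j = 0 then (1 : ℂ) else 2)
              * ((besselI (j * (c.m : ℤ)) (τ / D) : ℂ) * c.cT j)) ^ D).re)) / (2 * π) ^ D
        ≤ ((c.hi n : ℚ) : ℝ) := by
  obtain ⟨h1, -, -, h4⟩ := c.checkT_spec D h
  exact c.soundT_of_ioiBlockT D h (fun n' hn => c.ioi_blockT D (c.paramsT_of_paramsOKT D h1) h4 n' hn)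
    n hn1 hn4

/-- `checkT` from its four conjuncts (as proved separately by an instance file).
[cite: FitznerVanDerHofstad2016NoBLE, §5.1.1 (5.4)–(5.5) pp. 1089–1090] -/
theorem checkT_intro (h1 : c.paramsOKT D = true) (h2 : c.finalCheckT D = true)
    (h3 : c.poissonCheckT D = true) (h4 : c.tailCheckT D = true) : c.checkT D = true := by
  simp only [TwCert.checkT, h1, h2, h3, h4, Bool.and_self]

/-- **Soundness from the four conjuncts** (the form an instance file uses). [cite: FitznerVanDerHofstad2016NoBLE, §5.1.1 (5.2)–(5.5) pp. 1089–1090] -/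
theorem soundT_of_parts (h1 : c.paramsOKT D = true) (h2 : c.finalCheckT D = true)
    (h3 : c.poissonCheckT D = true) (h4 : c.tailCheckT D = true) (n : ℕ) (hn1 : 1 ≤ n) (hn4 : n ≤ 4) :
    ((c.lo n : ℚ) : ℝ)
        ≤ ((n - 1) ! : ℝ)⁻¹ * (∫ τ in Ioi (0:ℝ), τ ^ (n - 1) * (Real.exp (-τ) *
            ((∑ j ∈ Finset.range (c.J + 1), (if j = 0 then (1 : ℂ) else 2)
              * ((besselI (j * (c.m : ℤ)) (τ / D) : ℂ) * c.cT j)) ^ D).re)) / (2 * π) ^ D ∧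
    ((n - 1) ! : ℝ)⁻¹ * (∫ τ in Ioi (0:ℝ), τ ^ (n - 1) * (Real.exp (-τ) *
            ((∑ j ∈ Finset.range (c.J + 1), (if j = 0 then (1 : ℂ) else 2)
              * ((besselI (j * (c.m : ℤ)) (τ / D) : ℂ) * c.cT j)) ^ D).re)) / (2 * π) ^ D
        ≤ ((c.hi n : ℚ) : ℝ) :=
  c.soundT D (c.checkT_intro D h1 h2 h3 h4) n hn1 hn4

end TwCert

end TailBlock

end Literature.Probability.FitznerVanDerHofstad2017.SeedCert
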